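import Literature.MathematicalPhysics.QuantumFieldTheory.Balaban1983to89.B5Prop11Plancherel
import Literature.MathematicalPhysics.QuantumFieldTheory.Balaban1983to89.B5G183RateOp
import Literature.MathematicalPhysics.QuantumFieldTheory.Balaban1983to89.B5G183RateL2Asm

/-!
# Bałaban [CMP 95 (1984)] (1.83)/(1.89) at `U = 1`: the η-RATE OF `𝒢 = Δ_a⁻¹`, `∇_ν𝒢`, `𝒢∇_ν^*` ON THE
LATTICE HILBERT SPACE `ℓ²(T_η; ℂ^d)` — `‖𝒢^{(η/R)} − J_R 𝒢^{(η)} J_Rᴴ‖ ≤ CT(d,a)·η` (and `≤ CTL(d,a)·η` for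
the two first-order items) on EVERY finite unit torus, the `p′ = 0` coset included (the Plancherel step of
the rate; linear theory, explicit constants, no conditionals)

HONEST FRAMING (cell `pub-balaban`, T⁴ programme, estimate NE2 = U1a «η-rate, linear theory»).  This
module puts the fibrewise operator-norm η-rate of the sibling `B5G183RateOp` (fixed reduced momentum
`p′ ≠ 0`) ON THE ACTUAL LATTICE HILBERT SPACE of b05's `B5Prop11Plancherel`: the object is
`calG n hn M a ha`, THE operator on `ℓ²(T_η; ℂ^d)` (`η = 1/n`, finite torus with `M_μ ≥ 1` unit sites
per direction) whose Fourier blocks over the cosets `p = p′ + l` are Bałaban's matrices (1.83) and his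
printed `p′ = 0` values, for the TRIVIAL background `U = 1`.  Nothing here is infinite-volume (the
bound is uniform in the torus `M` and in `η`, but no limit object is constructed), nothing is a mass
gap, nothing is uniform in a coupling, and nothing in this file is progress on any Clay problem or on
the summit statement of this programme; it is finite-dimensional linear algebra (unitary conjugation,
re-indexing along cosets, block-diagonal norms, diagonal zero blocks) on top of ACCEPTED kernel
modules cited BY NAME (`B5Prop11Plancherel`, `B5G183RateOp`, `B5G183RateL2Asm`).  All theorems are tagged `[folklore]`: the operator is Bałaban's (1.83), its
uniform bound is Prop. 1.1 (1.89) as typed by b05 (`B5Prop11Plancherel.opNorm_calG_le`, not re-proved),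
the pairing of alias classes between two lattice spacings and the replace-and-bound mechanism of the RATE
are King's [King1986] §4 p. 672–673 (scalar `U(1)` Higgs model); the two-level injection `J_R`, the
packaging and every constant are OURS and are NOT attributed to either author.  Bałaban prints NO rate
in `η`.  `[cite: …]` tags locate TEXT, never a proof.

WHAT IS PRINTED (renders in this cell: [Balaban1984PropagatorsI] pp. 23, 31–33 — folder
`b2b-balaban-ref1/pages/1984-cmp95-propagators-rt-I/`, p. 31 = render p015 re-read by this seat for the
`p′ = 0` values; [King1986] = C. King, Commun. Math. Phys. 102
(1986) 649–677, pp. 672–673; quotations inherited verbatim from `B5Prop11Plancherel`, `B5G183Rate`,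
`B5G183RateOp`).  Bałaban p. 23, (1.29): «The momentum representation on an arbitrary torus
T′_η = {x ∈ ηZ^d : −L′_μ ≤ x_μ < L′_μ, μ = 1, …, d} is introduced by the Fourier transform
f̃(p) = Σ_{x∈T′_η} η^d e^{−ip·x} f(x), p ∈ T̃′_η, f(x) = (2π)^{−d} Σ_{p∈T̃′_η} (Π_{μ=1}^{d} π/L′_μ) e^{ix·p} f̃(p)»;
p. 23 after (1.31): «p ∈ T̃_η is represented as a sum p = p′ + l, p′ ∈ T̃₁^{(k)} and l = (l₁, …, l_d),
l_μ = 2πm_μ, m_μ is an integer».  p. 31, (1.83)–(1.84): «To investigate better the operator G we write it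
in momentum representation: Ã_μ(p′ + l) = (GJ)~_μ(p′ + l) = … (1.83) for p′ ≠ 0, Ã_μ(l) = (1/Δ(l)) J̃_μ(l),
Ã_μ(0) = a^{−1} J̃_μ(0)».  p. 33: «Proposition 1.1. The operator G is a symmetric operator on L²(T_η) and
‖GJ‖, ‖∇GJ‖, ‖G∇*J‖, ‖∇G∇*J‖, ‖∇∇GJ‖, ‖G∇*∇*J‖ ≤ γ₀^{−1}‖J‖, (1.89) with a positive constant γ₀
independent of k, T_η, and depending on d only (if we put a = 1).»  King p. 672, on the two-spacing
comparison of his kernels ((4.19)): «Also `m ∈ 2πL^kZ^d` and `|m_μ| ≤ πL^k(L^n − 1)` for L odd»; «We first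
bound the terms in (4.19) with `m ≠ 0` as follows: … `≤ CL^{−γk}`» (4.23); «To analyze the `m = 0` term in
(4.19), we successively replace each factor by the corresponding one … and bound the error.»; p. 673,
(4.31): `|Δ^{η′}(p′+l)⁻¹ − Δ^{η}(p′+l)⁻¹| ≤ CL^{−2k}`.  [v1.1] King p. 653 (render king p005 read by
this seat), (2.10): «The averaging operators used to map configurations on Ω into configurations on
Ω^{(k)} are Q_k A_μ(y) = L^{−kd} Σ_{x∈B^k(y)} A_μ(x)» — located only, to contrast with our SAMPLING `Q`
of §6; not used in any proof.

THE COMPARISON CONVENTION (ours; this is the content of NOT-CLAIMED (iii) of `B5G183RateOp`, now typed).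
Two lattices `T_η ⊂ T_{η/R}` over the SAME unit torus (`M_μ` unit sites, `η = 1/N`, refinement `R ≥ 1`)
have the same coarse dual torus `T̃_1 ∋ q` (`B5Prop11Plancherel.Tor M`, reduced momentum
`p′ = sOf M q ∈ [−π, π]^d`), and the cosets over `q` have `N^d` resp. `(RN)^d` alias classes.  King's
`m = 0` identification pairs the level-`N` class `k` with the level-`RN` class `ιk`
(`ι = B5Hk163Rate.iota`: the class with the SAME symmetric representative `q̃ ∈ (−πN, πN]^d`,
`B5Hk163Rate.symmAlias_iota`); the remaining level-`RN` classes (`m ≠ 0`, `‖q̃″‖ ≥ πN`) are unpaired.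
We type this pairing as the isometry `P_R(p′)` (`Pmat`, the matrix of `B5G183RateOp.plant`:
`plant R p′ A = P A Pᴴ`, `Pᴴ P = 1`), block-diagonal over `q` (`Jhat`), and conjugated back to position
space by b05's unitary vector DFTs: `J_R = F_{η/R}^* Ĵ_R F_η : ℓ²(T_η; ℂ^d) → ℓ²(T_{η/R}; ℂ^d)` (`Jmat`) —
the plane wave `e^{iq̃·x}` on the `η`-lattice goes to the plane wave with the SAME physical momentum on
the `η/R`-lattice (band-limited / trigonometric interpolation, up to the factor `R^{−d/2}` that makes it
an `ℓ²`-isometry for counting measures: the point identity `(J_R f)(R·x) = R^{−d/2} f(x)` at coarse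
points is §6, `Jmat_mulVec_cpt` / `Smp_mul_Jmat`).  `J_Rᴴ J_R = 1` (`Jmat_isometry`).

WHAT IS TYPED HERE (all at `m² = 0`, `U = 1`; hypotheses ONLY `1 ≤ N`, `1 ≤ R` (`1 ≤ R·N`), `0 < a`,
any `d`, any unit torus `M` with `M_μ ≥ 1`; NO perturbative / background / (B), (B^μ) / `BetaPertH`
conditional anywhere — linear theory; η-currency `1/N` with no loss):
 §1 abstract `ℓ²`-operator algebra of «planted» block families: for unitaries `U, U′`, coset equivalences
    `e, e′`, block families `B, B′` and planting blocks `P_q`, the position-space difference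
    `F′^*(⊕B′)F′ − J (F^*(⊕B)F) Jᴴ`, `J = F′^*(⊕P)F`, IS `F′^*(⊕_q (B′_q − P_q B_q P_qᴴ))F′`
    (`diff_planted_eq`), hence its norm is `≤ C` as soon as every coset block is (`opNorm_diff_planted_le`,
    via b05's `opNorm_le_of_blocks`); `Jᴴ J = 1` from `P_qᴴ P_q = 1` (`planted_isometry`); and the
    compression form `‖Jᴴ X′ J − X‖ ≤ ‖X′ − J X Jᴴ‖` for an isometry `J` (`opNorm_compression_le`).
 §2 `Pmat N R p′`, the `0/1` matrix of King's pairing: `plant R p′ A = Pmat A Pmatᴴ` (`plant_eq_conj`),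
    `Pmatᴴ Pmat = 1` (`Pmat_conjTranspose_mul_self`, from `B5Hk163Rate.iota_injective`).
 §3 THE `p′ = 0` COSET (not covered by the fibrewise modules, which assume `p′ ≠ 0`): Bałaban's zero fibre
    `zeroFib n a = diag(a⁻¹ at l = 0, Δ^{(n)}(l)⁻¹ at l ≠ 0)` (b05's `B5Prop11Bound.G₀`, = `blocks … 0`)
    satisfies `‖zeroFib (RN) a − P zeroFib N a Pᴴ‖ ≤ Czr·N⁻²`, `Czr = π²/24 + 1/4` (`opNorm_zeroFib_rate`):
    the difference is DIAGONAL; the constant mode contributes `a⁻¹ − a⁻¹ = 0` (`ι0 = 0`,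
    `B5Hk163RateSum.iota_zero`), a paired mode `l = 2πk ≠ 0` contributes King's (4.31)
    `|Δ^{(RN)}(q̃)⁻¹ − Δ^{(N)}(q̃)⁻¹| ≤ (π²/24)N⁻²` (`B5G183Rate.inv_DeltaXir_sub_abs`, both symbols read at
    the common representative `q̃` by `2πn`-periodicity `King1986.DeltaXir_symmAlias`), an unpaired mode
    `Δ^{(RN)}(q̃″)⁻¹ ≤ (4N²)⁻¹` (`B5G183RateSum.diag_unpaired_le`).
 §4 `Jhat`, `Jmat`, `Jmat_isometry`; the blockwise rate over every coset `blocks_rate` (`p′ ≠ 0`: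
    `B5G183RateOp.opNorm_G_rate`, `≤ Cop(d,a)/N`; `p′ = 0`: §3); the constant `CT d a = max (Cop d a) Czr`;
    the MAIN THEOREM `opNorm_calG_rate : ‖calG (R*N) … − Jmat * calG N … * Jmatᴴ‖ ≤ CT d a / N`, its
    compression form `opNorm_calG_rate_compression : ‖Jmatᴴ * calG (R*N) … * Jmat − calG N …‖ ≤ CT d a / N`
    (the fine-lattice `𝒢` read on band-limited fields IS the coarse-lattice `𝒢` up to `O(η)`), and side by
    side with b05's uniform bound `opNorm_calG_le_and_rate : ‖𝒢^{(η)}‖ ≤ Cst d a ∧ (rate)`.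
 §5 THE FIRST-ORDER ITEMS `∇_ν𝒢`, `𝒢∇_ν^*` of (1.89): b05's `fdiff_mul_mulW` / `mulW_mul_star_fdiff` /
    `reindex_conj_mulW` put them in the block form of §1 with coset blocks `D_{∂_ν(p′+·)} G(p′) D_1^*` resp.
    `D_1 G(p′) D_{∂_ν(p′+·)}^*` (`mulW_eq_conj_blocks`, `fsym_mul_one_restrict`: ON THE COSET the symbol of
    `∇_ν` IS `∂_ν(p′+l) = B5Prop11Fiber.dSym`, b05's `fsym_emb`); the `p′ ≠ 0` cosets are EXACTLY the kernel
    currencies `B5G183RateL2Asm.orderOneOpRateResidualL_holds` / `orderOneOpRateResidualR_holds`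
    (`Casm(d,a)/N`); the `p′ = 0` coset is a first-order diagonal block: constant mode `∂_ν(0) = 0`
    (`dSym_const_zero`), paired modes `‖∂^{(RN)}Δ^{(RN)⁻¹} − ∂^{(N)}Δ^{(N)⁻¹}‖(q̃) ≤ Cdg/N`
    (`diag_weight_rate_le_zero`, the `p′ = 0`, `l ≠ 0` twin of `B5G183RateL2Op.diag_weight_rate_le`, from
    `B5G183RateL2.dSym_rate_le`, `norm_dSym_le`, King's (4.31)), unpaired modes `≤ π/(4N)`
    (`B5G183RateL2Op.diag_weight_unpaired_le` verbatim) — `opNorm_zeroFibL_rate`, and the right weight by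
    adjunction (`sandwichR_zeroFib_eq_conjTranspose`, `opNorm_zeroFibR_rate`), `CzrL = Cdg + π/4`;
    whence `blocksL_rate` / `blocksR_rate` with `CTL d a = max (Casm d a) CzrL` and the MAIN FIRST-ORDER
    THEOREMS `opNorm_fdiff_calG_rate : ‖∇_ν𝒢^{(RN)} − Jmat (∇_ν𝒢^{(N)}) Jmatᴴ‖ ≤ CTL d a / N`,
    `opNorm_calG_star_fdiff_rate : ‖𝒢^{(RN)}∇_ν^* − Jmat (𝒢^{(N)}∇_ν^*) Jmatᴴ‖ ≤ CTL d a / N`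
    (`∇_ν = B5Prop11Plancherel.fdiff (fine n M) n ν`, lattice factor `η⁻¹ = n`), and the summary
    `orderLeOne_uniform_and_rate` (b05's three uniform bounds ∧ the three rates).
 §6 [v1.1, additive] THE COARSE-POINT IDENTITY: with the coarse site map `cpt : T_η → T_{η/R}`
    (`j ↦ R j`) and the SAMPLING matrix `Smp` (`(Q g)(x) = g(R·x)`), **`Smp_mul_Jmat : Q J_R = R^{−d/2}·1`**
    and **`Jmat_mulVec_cpt : (J_R f)(R·x, μ) = R^{−d/2} f(x, μ)`** (`R^{−d/2} = (√(R^d))⁻¹`); mechanism: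
    `(ι_R k)_ν ≡ k_ν (mod N)` (`iota_cast`), so the planted plane wave and the original one agree on the
    coarse points (`chi_emb_iota_cpt`), `Ĵ_R` has a single `1` per coarse mode (`Jhat_apply_emb`),
    `Q F_{RN}^* Ĵ_R = (|T_η|/|T_{η/R}|)^{1/2} F_η^*` (`Smp_star_dftV_Jhat`), `|T_{η/R}| = R^d|T_η|`
    (`card_fine_mul`).  As the range of `J_R` is the planted band, `J_R` = `R^{−d/2}` × the trigonometric
    (band-limited) interpolation `T_η → T_{η/R}` (interpretation; not typed); King's block-AVERAGING `Q_k` of [King1986] (2.10) p.653 is a different left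
    inverse candidate (`Q_avg J_R ≠ c·1`) and is not typed.

WHAT IS NOT CLAIMED (typed residuals, owners wanted — see the cell records): (i) the SECOND-ORDER items of
(1.89) on the torus (`∇_ν𝒢∇_{ν′}^*`, `∇_ν∇_{ν′}𝒢`, `𝒢∇_ν^*∇_{ν′}^*`) and their rates: b05 types their uniform
bounds (`opNorm_fdiff_calG_star_fdiff_le`, …); in the unweighted `1/N` currency the fibrewise order-two
rate is FALSE for every constant (`B5G183RateO2Op.not_orderTwoOpRateResidual`), the weighted currencies and
their exponent laws are `B5G183RateO2Op` / `B5G183RateWThetaCentre`; no torus packaging of those is in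
this file; nor are the gradient-vector forms of (1.89) (all `ν` at once: an extra `√d`, elementary);
(ii) rates against NON-spectral two-level maps (block averaging, piecewise-constant extension), and any
statement in B5's weighted norms (1.29) other than through the normalisation remark of b05
(`(cF)⁻¹X(cF) = F⁻¹XF`); (iii) that (1.83) is the
momentum representation of `Δ_a⁻¹` defined through (1.71)–(1.82) (`calG` is DEFINED by its blocks — b05's
caveat (1)); (iv) `U ≠ 1`, (1.99), derivatives in `p′` and position-space decay (Prop. 1.2 (1.110)–(1.111)
p. 35), the later papers; (v) optimality of `CT` (in particular the zero coset is `O(N⁻²)`, the `p′ ≠ 0`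
cosets `O(N⁻¹)` with the crude `Cop`).
-/

noncomputable section

namespace Literature.MathematicalPhysics.QuantumFieldTheory.Balaban1983to89.B5G183RateTorus

open scoped BigOperators ComplexConjugate Matrix Matrix.Norms.L2Operator
open Finset Complex
open Literature.MathematicalPhysics.QuantumFieldTheory.Balaban1983to89.B4Strip
open Literature.MathematicalPhysics.QuantumFieldTheory.Balaban1983to89.B5Prop11Leaves
open Literature.MathematicalPhysics.QuantumFieldTheory.Balaban1983to89.B5Prop11Fiber
open Literature.MathematicalPhysics.QuantumFieldTheory.Balaban1983to89.B5Prop11Bound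
open Literature.MathematicalPhysics.QuantumFieldTheory.Balaban1983to89.B5Prop11Plancherel
open Literature.MathematicalPhysics.QuantumFieldTheory.Balaban1983to89.B5Hk163Rate
open Literature.MathematicalPhysics.QuantumFieldTheory.Balaban1983to89.B5Hk163RateSum
open Literature.MathematicalPhysics.QuantumFieldTheory.Balaban1983to89.B5G183Rate
open Literature.MathematicalPhysics.QuantumFieldTheory.Balaban1983to89.B5G183RateSum
open Literature.MathematicalPhysics.QuantumFieldTheory.Balaban1983to89.B5G183RateOp
open Literature.MathematicalPhysics.QuantumFieldTheory.Balaban1983to89.B5G183RateL2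
open Literature.MathematicalPhysics.QuantumFieldTheory.Balaban1983to89.B5G183RateL2Op
open Literature.MathematicalPhysics.QuantumFieldTheory.Balaban1983to89.B5G183RateL2Asm
open Literature.MathematicalPhysics.QuantumFieldTheory.King1986

variable {d : ℕ}

/-! ## §1 Abstract two-level Plancherel algebra: planted conjugation, block form, isometry [folklore] -/

section Abstract

variable {m m' b b' o : Type*}

/-- reindexing commutes with products (square-free form of `Matrix.submatrix_mul_equiv`). [folklore] -/
theorem reindex_mul_reindex {l n p l' n' p' : Type*} [Fintype n] [Fintype n']
    (e₁ : l ≃ l') (e₂ : n ≃ n') (e₃ : p ≃ p') (A : Matrix l n ℂ) (B : Matrix n p ℂ) :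
    Matrix.reindex e₁ e₂ A * Matrix.reindex e₂ e₃ B = Matrix.reindex e₁ e₃ (A * B) := by
  simp only [Matrix.reindex_apply]
  exact Matrix.submatrix_mul_equiv A B e₁.symm e₂.symm e₃.symm

/-- **the planted conjugate in block form.**  With `X = U^* (⊕_q B_q) U` (blocks along `e`) and the
two-level injection `J = U'^* (⊕_q P_q) U` (blocks along `e′ ← e`), one has
`J X Jᴴ = U'^* (⊕_q P_q B_q P_qᴴ) U'`. [folklore] -/
theorem planted_conj_eq [Fintype m] [DecidableEq m] [Fintype m'] [Fintype b] [Fintype b']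
    [Fintype o] [DecidableEq o] {U : Matrix m m ℂ} (hU : U * star U = 1) (U' : Matrix m' m' ℂ)
    (e : m ≃ b × o) (e' : m' ≃ b' × o) (B : o → Matrix b b ℂ) (P : o → Matrix b' b ℂ) :
    (star U' * Matrix.reindex e'.symm e.symm (Matrix.blockDiagonal P) * U)
        * (star U * (Matrix.reindex e e).symm (Matrix.blockDiagonal B) * U)
        * (star U' * Matrix.reindex e'.symm e.symm (Matrix.blockDiagonal P) * U)ᴴ
      = star U' * (Matrix.reindex e' e').symm
          (Matrix.blockDiagonal fun q => P q * B q * (P q)ᴴ) * U' := by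
  have hPt : (star U' * Matrix.reindex e'.symm e.symm (Matrix.blockDiagonal P) * U)ᴴ
      = star U * Matrix.reindex e.symm e'.symm (Matrix.blockDiagonal fun q => (P q)ᴴ) * U' := by
    rw [Matrix.conjTranspose_mul, Matrix.conjTranspose_mul, Matrix.conjTranspose_reindex,
      Matrix.blockDiagonal_conjTranspose, Matrix.star_eq_conjTranspose, Matrix.star_eq_conjTranspose,
      Matrix.conjTranspose_conjTranspose, Matrix.mul_assoc]
  rw [hPt, Matrix.reindex_symm, Matrix.reindex_symm]
  set RP := Matrix.reindex e'.symm e.symm (Matrix.blockDiagonal P)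
  set RB := Matrix.reindex e.symm e.symm (Matrix.blockDiagonal B)
  set RPt := Matrix.reindex e.symm e'.symm (Matrix.blockDiagonal fun q => (P q)ᴴ)
  calc star U' * RP * U * (star U * RB * U) * (star U * RPt * U')
      = star U' * (RP * (U * star U) * RB * (U * star U) * RPt) * U' := by
        simp only [Matrix.mul_assoc]
    _ = star U' * (RP * RB * RPt) * U' := by rw [hU, Matrix.mul_one, Matrix.mul_one]
    _ = _ := by
        simp only [RP, RB, RPt]
        rw [reindex_mul_reindex, reindex_mul_reindex, ← Matrix.blockDiagonal_mul,
          ← Matrix.blockDiagonal_mul]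

/-- **the η-difference in block form**: `X′ − J X Jᴴ = U'^* (⊕_q (B′_q − P_q B_q P_qᴴ)) U'`. [folklore] -/
theorem diff_planted_eq [Fintype m] [DecidableEq m] [Fintype m'] [Fintype b] [Fintype b']
    [Fintype o] [DecidableEq o] {U : Matrix m m ℂ} (hU : U * star U = 1) (U' : Matrix m' m' ℂ)
    (e : m ≃ b × o) (e' : m' ≃ b' × o) (B : o → Matrix b b ℂ) (B' : o → Matrix b' b' ℂ)
    (P : o → Matrix b' b ℂ) :
    star U' * (Matrix.reindex e' e').symm (Matrix.blockDiagonal B') * U'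
        - (star U' * Matrix.reindex e'.symm e.symm (Matrix.blockDiagonal P) * U)
          * (star U * (Matrix.reindex e e).symm (Matrix.blockDiagonal B) * U)
          * (star U' * Matrix.reindex e'.symm e.symm (Matrix.blockDiagonal P) * U)ᴴ
      = star U' * (Matrix.reindex e' e').symm
          (Matrix.blockDiagonal fun q => B' q - P q * B q * (P q)ᴴ) * U' := by
  rw [planted_conj_eq hU U' e e' B P, ← Matrix.sub_mul, ← Matrix.mul_sub]
  congr 2
  simp only [Matrix.reindex_symm, Matrix.reindex_apply]
  rw [show (fun q => B' q - P q * B q * (P q)ᴴ) = B' - (fun q => P q * B q * (P q)ᴴ) from rfl,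
    Matrix.blockDiagonal_sub, Matrix.submatrix_sub]
  rfl

/-- **the abstract two-level Plancherel bound**: if every block difference has norm `≤ C` then so has
`X′ − J X Jᴴ` (`U′` unitary). [folklore] -/
theorem opNorm_diff_planted_le [Fintype m] [DecidableEq m] [Fintype m'] [DecidableEq m']
    [Fintype b] [Fintype b'] [DecidableEq b'] [Fintype o] [DecidableEq o] {U : Matrix m m ℂ} (hU : U * star U = 1) {U' : Matrix m' m' ℂ}
    (hU' : U' ∈ Matrix.unitaryGroup m' ℂ)
    (e : m ≃ b × o) (e' : m' ≃ b' × o) (B : o → Matrix b b ℂ) (B' : o → Matrix b' b' ℂ)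
    (P : o → Matrix b' b ℂ) {C : ℝ} (hC : 0 ≤ C) (hB : ∀ q, ‖B' q - P q * B q * (P q)ᴴ‖ ≤ C) :
    ‖star U' * (Matrix.reindex e' e').symm (Matrix.blockDiagonal B') * U'
        - (star U' * Matrix.reindex e'.symm e.symm (Matrix.blockDiagonal P) * U)
          * (star U * (Matrix.reindex e e).symm (Matrix.blockDiagonal B) * U)
          * (star U' * Matrix.reindex e'.symm e.symm (Matrix.blockDiagonal P) * U)ᴴ‖ ≤ C := by
  rw [diff_planted_eq hU U' e e' B B' P]
  have hU'1 : U' * star U' = 1 := by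
    have h := Matrix.mem_unitaryGroup_iff.mp hU'
    exact h
  refine opNorm_le_of_blocks hU' e' _ (fun q => B' q - P q * B q * (P q)ᴴ) ?_ hC hB
  set Y := (Matrix.reindex e' e').symm (Matrix.blockDiagonal fun q => B' q - P q * B q * (P q)ᴴ)
  calc Matrix.reindex e' e' (U' * (star U' * Y * U') * star U')
      = Matrix.reindex e' e' ((U' * star U') * Y * (U' * star U')) := by simp only [Matrix.mul_assoc]
    _ = Matrix.reindex e' e' Y := by rw [hU'1, Matrix.one_mul, Matrix.mul_one]
    _ = _ := by simp only [Y, Equiv.apply_symm_apply]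

/-- **isometry**: if every `P_q` is an isometry (`P_qᴴ P_q = 1`) and `U`, `U′` are unitary then
`Jᴴ J = 1`. [folklore] -/
theorem planted_isometry [Fintype m] [DecidableEq m] [Fintype m'] [DecidableEq m']
    [Fintype b] [DecidableEq b] [Fintype b'] [Fintype o] [DecidableEq o] {U : Matrix m m ℂ} (hU : star U * U = 1) {U' : Matrix m' m' ℂ}
    (hU' : U' * star U' = 1) (e : m ≃ b × o) (e' : m' ≃ b' × o) (P : o → Matrix b' b ℂ)
    (hP : ∀ q, (P q)ᴴ * P q = 1) :
    (star U' * Matrix.reindex e'.symm e.symm (Matrix.blockDiagonal P) * U)ᴴ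
        * (star U' * Matrix.reindex e'.symm e.symm (Matrix.blockDiagonal P) * U) = 1 := by
  rw [Matrix.conjTranspose_mul, Matrix.conjTranspose_mul, Matrix.conjTranspose_reindex,
    Matrix.blockDiagonal_conjTranspose, Matrix.star_eq_conjTranspose,
    Matrix.conjTranspose_conjTranspose]
  set RP := Matrix.reindex e'.symm e.symm (Matrix.blockDiagonal P)
  set RPt := Matrix.reindex e.symm e'.symm (Matrix.blockDiagonal fun q => (P q)ᴴ)
  have hU'' : U' * U'ᴴ = 1 := by rw [← Matrix.star_eq_conjTranspose]; exact hU'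
  calc _ = Uᴴ * (RPt * (U' * U'ᴴ) * RP) * U := by
        simp only [RP, RPt, Matrix.mul_assoc]
    _ = Uᴴ * (RPt * RP) * U := by rw [hU'', Matrix.mul_one]
    _ = Uᴴ * U := by
        simp only [RP, RPt]
        rw [reindex_mul_reindex, ← Matrix.blockDiagonal_mul]
        have h1 : (Matrix.blockDiagonal fun q => (P q)ᴴ * P q) = 1 := by
          rw [show (fun q => (P q)ᴴ * P q) = (1 : o → Matrix b b ℂ) from funext hP]
          exact Matrix.blockDiagonal_one
        rw [h1, Matrix.reindex_apply, Matrix.submatrix_one_equiv, Matrix.mul_one]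
    _ = 1 := by rw [← Matrix.star_eq_conjTranspose]; exact hU

/-- **compression form**: `Jᴴ J = 1` and `‖X′ − J X Jᴴ‖ ≤ C` give `‖Jᴴ X′ J − X‖ ≤ C`. [folklore] -/
theorem opNorm_compression_le [Fintype m] [DecidableEq m] [Fintype m'] [DecidableEq m']
    {J : Matrix m' m ℂ} (hJ : Jᴴ * J = 1) (X : Matrix m m ℂ)
    (X' : Matrix m' m' ℂ) {C : ℝ} (h : ‖X' - J * X * Jᴴ‖ ≤ C) : ‖Jᴴ * X' * J - X‖ ≤ C := by
  have hJ1 : ‖J‖ ≤ 1 := by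
    by_cases hm : Nonempty m
    · have h2 : ‖J‖ * ‖J‖ = 1 := by
        rw [← Matrix.l2_opNorm_conjTranspose_mul_self, hJ]
        exact norm_one
      nlinarith [norm_nonneg J]
    · have : J = 0 := by
        ext i j
        exact absurd ⟨j⟩ hm
      rw [this, norm_zero]; exact zero_le_one
  have hJt : ‖Jᴴ‖ ≤ 1 := by rw [Matrix.l2_opNorm_conjTranspose]; exact hJ1
  have e1 : Jᴴ * X' * J - X = Jᴴ * (X' - J * X * Jᴴ) * J := by
    rw [Matrix.mul_sub, Matrix.sub_mul]
    congr 1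
    calc X = 1 * X * 1 := by rw [Matrix.one_mul, Matrix.mul_one]
      _ = (Jᴴ * J) * X * (Jᴴ * J) := by rw [hJ]
      _ = Jᴴ * (J * X * Jᴴ) * J := by simp only [Matrix.mul_assoc]
  rw [e1]
  have hC : 0 ≤ C := le_trans (norm_nonneg _) h
  calc ‖Jᴴ * (X' - J * X * Jᴴ) * J‖ ≤ ‖Jᴴ * (X' - J * X * Jᴴ)‖ * ‖J‖ := Matrix.l2_opNorm_mul _ _
    _ ≤ (‖Jᴴ‖ * ‖X' - J * X * Jᴴ‖) * ‖J‖ :=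
        mul_le_mul_of_nonneg_right (Matrix.l2_opNorm_mul _ _) (norm_nonneg _)
    _ ≤ (1 * C) * 1 := by
        refine mul_le_mul (mul_le_mul hJt h (norm_nonneg _) zero_le_one) hJ1 (norm_nonneg _) ?_
        positivity
    _ = C := by ring

end Abstract

/-! ## §2 King's pairing as a partial isometry of the alias classes; `plant = P · Pᴴ` [folklore] -/

section PlantIso

variable {N R : ℕ} [NeZero R]

/-- `unpair k″ = some k ↔ ι k = k″`. [folklore] -/
theorem unpair_eq_some_iff (hN : 1 ≤ N) {s : Fin d → ℝ} (hs : ∀ ν, |s ν| ≤ Real.pi)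
    (k'' : Fin d → Fin (R * N)) (k : Fin d → Fin N) :
    unpair R s k'' = some k ↔ iota R k s = k'' := by
  constructor
  · intro h
    unfold unpair at h
    by_cases hex : ∃ k₁ : Fin d → Fin N, iota R k₁ s = k''
    · rw [dif_pos hex, Option.some.injEq] at h
      rw [← h]
      exact hex.choose_spec
    · rw [dif_neg hex] at h
      exact absurd h (by simp)
  · rintro rfl
    exact unpair_iota hN hs k

/-- **the planting isometry** `P = P_R(p′)`: the `0/1` matrix sending the level-`N` basis vector `(k, μ)`
to the level-`RN` basis vector `(ι k, μ)` with the same physical momentum (King's `m = 0` pairing).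
[cite: King1986, (4.19) p.672] [folklore] -/
def Pmat (N R : ℕ) [NeZero R] (s : Fin d → ℝ) :
    Matrix ((Fin d → Fin (R * N)) × Fin d) ((Fin d → Fin N) × Fin d) ℂ :=
  fun i j => if i = (iota R j.1 s, j.2) then 1 else 0

/-- entries of `P` on a paired row. [folklore] -/
theorem Pmat_apply_iota (hN : 1 ≤ N) {s : Fin d → ℝ} (hs : ∀ ν, |s ν| ≤ Real.pi)
    (k : Fin d → Fin N) (μ : Fin d) (j : (Fin d → Fin N) × Fin d) :
    Pmat N R s (iota R k s, μ) j = if j = (k, μ) then 1 else 0 := by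
  unfold Pmat
  have h : ((iota R k s, μ) = (iota R j.1 s, j.2)) ↔ j = (k, μ) := by
    constructor
    · intro h
      rw [Prod.mk.injEq] at h
      have h1 : k = j.1 := iota_injective hN hs h.1
      exact Prod.ext h1.symm h.2.symm
    · rintro rfl
      rfl
  simp only [h]

/-- entries of `P` on an unpaired row vanish. [folklore] -/
theorem Pmat_apply_unpaired {s : Fin d → ℝ} {k'' : Fin d → Fin (R * N)}
    (hu : ∀ k : Fin d → Fin N, iota R k s ≠ k'') (μ : Fin d) (j : (Fin d → Fin N) × Fin d) :
    Pmat N R s (k'', μ) j = 0 := by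
  unfold Pmat
  rw [if_neg]
  intro h
  rw [Prod.mk.injEq] at h
  exact hu j.1 h.1.symm

/-- `Pᴴ P = 1`: the planting is an isometry (`ι` injective). [folklore] -/
theorem Pmat_conjTranspose_mul_self (hN : 1 ≤ N) {s : Fin d → ℝ} (hs : ∀ ν, |s ν| ≤ Real.pi) :
    (Pmat N R s)ᴴ * Pmat N R s = 1 := by
  ext j j'
  rw [Matrix.mul_apply, Matrix.one_apply]
  have hP : ∀ i : (Fin d → Fin (R * N)) × Fin d, (Pmat N R s)ᴴ j i * Pmat N R s i j'
      = if i = (iota R j.1 s, j.2) then (if j = j' then 1 else 0) else 0 := by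
    intro i
    rw [Matrix.conjTranspose_apply]
    unfold Pmat
    by_cases hi : i = (iota R j.1 s, j.2)
    · rw [if_pos hi, if_pos hi, star_one, one_mul]
      by_cases hjj : j = j'
      · subst hjj; rw [if_pos hi, if_pos rfl]
      · rw [if_neg hjj, if_neg]
        intro hi'
        rw [hi, Prod.mk.injEq] at hi'
        exact hjj (Prod.ext (iota_injective hN hs hi'.1) hi'.2)
    · rw [if_neg hi, if_neg hi, star_zero, zero_mul]
  simp_rw [hP]
  rw [Finset.sum_ite_eq' Finset.univ (iota R j.1 s, j.2)]
  simp

/-- a planted product through a paired row: `Σ_j P_{(ιk,μ),j} A_{j,j′} = A_{(k,μ),j′}`. [folklore] -/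
theorem Pmat_mul_apply_iota (hN : 1 ≤ N) {s : Fin d → ℝ} (hs : ∀ ν, |s ν| ≤ Real.pi)
    {n' : Type*} (A : Matrix ((Fin d → Fin N) × Fin d) n' ℂ) (k : Fin d → Fin N) (μ : Fin d) (j' : n') :
    (Pmat N R s * A) (iota R k s, μ) j' = A (k, μ) j' := by
  rw [Matrix.mul_apply]
  simp_rw [Pmat_apply_iota hN hs k μ]
  simp

/-- a planted product through an unpaired row vanishes. [folklore] -/
theorem Pmat_mul_apply_unpaired {s : Fin d → ℝ} {k'' : Fin d → Fin (R * N)}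
    (hu : ∀ k : Fin d → Fin N, iota R k s ≠ k'') {n' : Type*}
    (A : Matrix ((Fin d → Fin N) × Fin d) n' ℂ) (μ : Fin d) (j' : n') :
    (Pmat N R s * A) (k'', μ) j' = 0 := by
  rw [Matrix.mul_apply]
  simp_rw [Pmat_apply_unpaired hu μ]
  simp

/-- **planting is conjugation by the planting isometry**: `ι_* A ι^* = P A Pᴴ`
(`B5G183RateOp.plant`). [folklore] -/
theorem plant_eq_conj (hN : 1 ≤ N) {s : Fin d → ℝ} (hs : ∀ ν, |s ν| ≤ Real.pi)
    (A : Matrix ((Fin d → Fin N) × Fin d) ((Fin d → Fin N) × Fin d) ℂ) :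
    plant R s A = Pmat N R s * A * (Pmat N R s)ᴴ := by
  ext ⟨i1, μ⟩ ⟨i1', μ'⟩
  rw [Matrix.mul_apply]
  by_cases hi : ∃ k : Fin d → Fin N, iota R k s = i1
  · obtain ⟨k, rfl⟩ := hi
    simp_rw [Pmat_mul_apply_iota hN hs A k μ, Matrix.conjTranspose_apply]
    by_cases hi' : ∃ k' : Fin d → Fin N, iota R k' s = i1'
    · obtain ⟨k', rfl⟩ := hi'
      rw [plant_iota_iota hN hs A k k' μ μ']
      simp_rw [Pmat_apply_iota hN hs k' μ']
      simp
    · push Not at hi'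
      rw [plant_col_unpaired A _ hi' μ']
      simp_rw [Pmat_apply_unpaired hi' μ']
      simp
  · push Not at hi
    rw [plant_row_unpaired A hi μ]
    simp_rw [Pmat_mul_apply_unpaired hi A μ]
    simp

end PlantIso

/-! ## §3 The `p′ = 0` coset: Bałaban's diagonal zero fibre `G₀` and its η-rate [folklore] -/

section ZeroCoset

variable {N R : ℕ} [NeZero N] [NeZero R]

/-- a matrix with vanishing off-diagonal entries has `ℓ²`-operator norm at most the largest diagonal
entry. [folklore] -/
theorem opNorm_le_of_offDiag_eq_zero {ι : Type*} [Fintype ι] [DecidableEq ι] (X : Matrix ι ι ℂ)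
    {C : ℝ} (hC : 0 ≤ C) (hoff : ∀ i j, i ≠ j → X i j = 0) (hdiag : ∀ i, ‖X i i‖ ≤ C) : ‖X‖ ≤ C := by
  refine opNorm_le_of_sq_le X hC fun x => ?_
  have key : ∀ i, ∑ j, X i j * x j = X i i * x i := by
    intro i
    rw [Finset.sum_eq_single i]
    · intro j _ hj; rw [hoff i j (Ne.symm hj), zero_mul]
    · intro h; exact absurd (Finset.mem_univ i) h
  simp_rw [key]
  rw [Finset.mul_sum]
  refine Finset.sum_le_sum fun i _ => ?_
  rw [norm_mul, mul_pow]
  exact mul_le_mul_of_nonneg_right (pow_le_pow_left₀ (norm_nonneg _) (hdiag i) 2) (sq_nonneg _)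

/-- the zero momentum lies in the reduced zone. [folklore] -/
theorem abs_zero_le_pi (ν : Fin d) : |(0 : Fin d → ℝ) ν| ≤ Real.pi := by
  simp [Real.pi_pos.le]

/-- at `p′ = 0` a NONZERO alias class has a nonzero symmetric representative `q̃ = 2πk − 2πNχ`.
[folklore] -/
theorem momSq_symmAlias_zero_pos {k : Fin d → Fin N} (hk : k ≠ 0) :
    0 < momSq (symmAlias N k (0 : Fin d → ℝ)) := by
  obtain ⟨ν, hν⟩ := Function.ne_iff.mp hk
  have hkν : (k ν : ℕ) ≠ 0 := fun h => hν (Fin.ext h)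
  have hkN : (k ν : ℕ) < N := (k ν).isLt
  have hπ := Real.pi_pos
  have hne : symmAlias N k (0 : Fin d → ℝ) ν ≠ 0 := by
    unfold symmAlias shiftr
    simp only [Pi.zero_apply, zero_add]
    rcases symmShift_le_one N k (0 : Fin d → ℝ) ν with h | h <;> rw [h] <;> push_cast
    · have : (0 : ℝ) < (k ν : ℕ) := by exact_mod_cast Nat.pos_of_ne_zero hkν
      nlinarith
    · have : ((k ν : ℕ) : ℝ) < N := by exact_mod_cast hkN
      nlinarith
  unfold momSq
  exact lt_of_lt_of_le (by positivity) (Finset.single_le_sum (f := fun μ => symmAlias N k 0 μ ^ 2)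
    (fun _ _ => sq_nonneg _) (Finset.mem_univ ν))

/-- `ι k = 0 ↔ k = 0` (at any reduced momentum of the zone). [folklore] -/
theorem iota_eq_zero_iff (hN : 1 ≤ N) {s : Fin d → ℝ} (hs : ∀ ν, |s ν| ≤ Real.pi) (k : Fin d → Fin N) :
    iota R k s = 0 ↔ k = 0 := by
  constructor
  · intro h
    have h0 : iota R (0 : Fin d → Fin N) s = 0 := iota_zero hN hs
    exact iota_injective hN hs (h.trans h0.symm)
  · rintro rfl; exact iota_zero hN hs

/-- the constant of the zero coset: King's `(4.31)` diagonal rate `π²/24` plus the unpaired bound `1/4`. [folklore] -/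
def Czr : ℝ := Real.pi ^ 2 / 24 + 1 / 4

/-- `0 ≤ Czr`. [folklore] -/
theorem Czr_nonneg : 0 ≤ Czr := by unfold Czr; positivity

/-- Bałaban's zero fibre at lattice parameter `n` (b05's `B5Prop11Plancherel.blocks` at `q = 0`):
`diag(a⁻¹ at l = 0, Δ^{(n)}(l)⁻¹ at l ≠ 0)`. [cite: Balaban1984PropagatorsI, (1.83) p.31 («Ã_μ(l) = Δ(l)⁻¹ J̃_μ(l), Ã_μ(0) = a⁻¹ J̃_μ(0)»)] -/
abbrev zeroFib (n : ℕ) [NeZero n] (a : ℝ) : Matrix ((Fin d → Fin n) × Fin d) ((Fin d → Fin n) × Fin d) ℂ :=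
  G₀ (d := d) (fun _ => (0 : Fin n)) a (fun k => DeltaXir n 0 (shiftr n k 0))

/-- off-diagonal entries of the zero fibre vanish. [folklore] -/
theorem zeroFib_apply_ne {n : ℕ} [NeZero n] (a : ℝ) {i j : (Fin d → Fin n) × Fin d} (h : i ≠ j) :
    zeroFib (d := d) n a i j = 0 := by
  unfold zeroFib G₀
  exact Matrix.diagonal_apply_ne _ h

/-- diagonal entries of the zero fibre. [folklore] -/
theorem zeroFib_apply_eq {n : ℕ} [NeZero n] (a : ℝ) (i : (Fin d → Fin n) × Fin d) :
    zeroFib (d := d) n a i i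
      = if i.1 = (fun _ => (0 : Fin n)) then 1 / (a : ℂ) else 1 / ((DeltaXir n 0 (shiftr n i.1 0) : ℝ) : ℂ) := by
  unfold zeroFib G₀
  exact Matrix.diagonal_apply_eq _ _

/-- **the η-rate of the zero coset**: `‖G₀^{(RN)} − P G₀^{(N)} Pᴴ‖ ≤ (π²/24 + 1/4)·N⁻²` — paired classes by
King's (4.31) (`B5G183Rate.inv_DeltaXir_sub_abs`), unpaired ones by `Δ^{(RN)} ≥ 4N²`
(`B5G183RateSum.diag_unpaired_le`), the constant mode `l = 0` exactly (`a⁻¹ − a⁻¹ = 0`).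
[cite: Balaban1984PropagatorsI, (1.83) p.31; King1986, (4.31) p.673, (4.23) p.672] [folklore] -/
theorem opNorm_zeroFib_rate (hN : 1 ≤ N) (hR : 1 ≤ R) (a : ℝ) :
    ‖zeroFib (d := d) (R * N) a
        - Pmat N R (0 : Fin d → ℝ) * zeroFib (d := d) N a * (Pmat N R (0 : Fin d → ℝ))ᴴ‖
      ≤ Czr * ((N : ℝ) ^ 2)⁻¹ := by
  have hs := abs_zero_le_pi (d := d)
  have hN0 : N ≠ 0 := by omega
  have hRN0 : R * N ≠ 0 := Nat.mul_ne_zero (by omega) hN0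
  have hπ := Real.pi_pos
  have hC : 0 ≤ Czr * ((N : ℝ) ^ 2)⁻¹ := mul_nonneg Czr_nonneg (by positivity)
  rw [← plant_eq_conj hN hs]
  refine opNorm_le_of_offDiag_eq_zero _ hC ?_ ?_
  · -- off-diagonal entries vanish
    rintro ⟨i1, μ⟩ ⟨i1', μ'⟩ hne
    rw [Matrix.sub_apply, zeroFib_apply_ne _ hne]
    by_cases hi : ∃ k : Fin d → Fin N, iota R k 0 = i1
    · obtain ⟨k, rfl⟩ := hi
      by_cases hi' : ∃ k' : Fin d → Fin N, iota R k' 0 = i1'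
      · obtain ⟨k', rfl⟩ := hi'
        rw [plant_iota_iota hN hs, zeroFib_apply_ne, sub_zero]
        intro h
        rw [Prod.mk.injEq] at h
        exact hne (by rw [h.1, h.2])
      · push Not at hi'
        rw [plant_col_unpaired _ _ hi', sub_zero]
    · push Not at hi
      rw [plant_row_unpaired _ hi, sub_zero]
  · -- diagonal entries
    rintro ⟨i1, μ⟩
    rw [Matrix.sub_apply]
    by_cases hi : ∃ k : Fin d → Fin N, iota R k 0 = i1
    · obtain ⟨k, rfl⟩ := hi
      rw [plant_iota_iota hN hs, zeroFib_apply_eq, zeroFib_apply_eq]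
      dsimp only
      by_cases hk : k = 0
      · -- the constant mode: both entries are `a⁻¹`
        subst hk
        have h1 : iota R (0 : Fin d → Fin N) (0 : Fin d → ℝ) = fun _ => 0 := iota_zero hN hs
        have h2 : (0 : Fin d → Fin N) = fun _ => 0 := rfl
        rw [if_pos h1, if_pos h2, sub_self, norm_zero]
        exact hC
      · have hι : ¬ iota R k (0 : Fin d → ℝ) = fun _ => 0 := fun h => hk ((iota_eq_zero_iff hN hs k).mp h)
        have hk' : ¬ k = fun _ => 0 := hk
        simp only [hι, hk', if_false]
        -- both symbols are evaluated at the common representative `q̃ = symmAlias N k 0`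
        have e1 : DeltaXir (R * N) 0 (shiftr (R * N) (iota R k 0) 0) = DeltaXir (R * N) 0 (symmAlias N k 0) := by
          rw [← DeltaXir_symmAlias hRN0, symmAlias_iota hN k hs]
        have e2 : DeltaXir N 0 (shiftr N k 0) = DeltaXir N 0 (symmAlias N k 0) := by
          rw [← DeltaXir_symmAlias hN0]
        rw [e1, e2, one_div, one_div, ← Complex.ofReal_inv, ← Complex.ofReal_inv, ← Complex.ofReal_sub,
          Complex.norm_real, Real.norm_eq_abs, abs_sub_comm]
        have h := inv_DeltaXir_sub_abs hN hR (fun ν => symmAlias_abs_le hN k hs ν)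
          (momSq_symmAlias_zero_pos hk)
        calc _ ≤ Real.pi ^ 2 / 24 * ((N : ℝ) ^ 2)⁻¹ := h
          _ ≤ Czr * ((N : ℝ) ^ 2)⁻¹ := by
              refine mul_le_mul_of_nonneg_right ?_ (by positivity)
              unfold Czr; linarith
    · push Not at hi
      rw [plant_row_unpaired _ hi, sub_zero, zeroFib_apply_eq]
      dsimp only
      have hi0 : ¬ i1 = fun _ => 0 := by
        intro h
        exact hi 0 ((iota_zero hN hs).trans h.symm)
      simp only [hi0, if_false]
      have e1 : DeltaXir (R * N) 0 (shiftr (R * N) i1 0) = DeltaXir (R * N) 0 (symmAlias (R * N) i1 0) := by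
        rw [← DeltaXir_symmAlias hRN0]
      obtain ⟨hpos, hle⟩ := diag_unpaired_le hN hR hs hi
      rw [e1, one_div, ← Complex.ofReal_inv, Complex.norm_real, Real.norm_eq_abs, abs_of_pos hpos]
      calc _ ≤ ((4 : ℝ) * (N : ℝ) ^ 2)⁻¹ := hle
        _ = 1 / 4 * ((N : ℝ) ^ 2)⁻¹ := by rw [mul_inv, one_div]
        _ ≤ Czr * ((N : ℝ) ^ 2)⁻¹ := by
            refine mul_le_mul_of_nonneg_right ?_ (by positivity)
            unfold Czr; nlinarith [hπ]

end ZeroCoset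

/-! ## §4 The two-level injection `J_R` on `ℓ²(T_η; ℂ^d)` and the torus operator-norm η-rate of `𝒢` [folklore] -/

section Torus

variable (N R : ℕ) [NeZero N] [NeZero R] (M : Fin d → ℕ) [hM : ∀ μ, NeZero (M μ)]

/-- the momentum-space injection `Ĵ_R`: block-diagonal over the coarse momenta `q ∈ T̃_1` (the SAME unit
torus at both levels), each block the planting isometry `P_R(p′(q))`, transported to (fine momentum,
component) indices along b05's coset parametrisations at levels `N` and `RN`. [folklore] -/
def Jhat : Matrix (Tor (fine (R * N) M) × Fin d) (Tor (fine N M) × Fin d) ℂ :=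
  Matrix.reindex (blockEquiv (R * N) M).symm (blockEquiv N M).symm
    (Matrix.blockDiagonal fun q : Tor M => Pmat N R (sOf M q))

/-- **the two-level injection** `J_R = F_{RN}^* Ĵ_R F_N : ℓ²(T_η; ℂ^d) → ℓ²(T_{η/R}; ℂ^d)` (`η = 1/N`):
Fourier transform on the `η`-lattice, keep every plane wave `e^{iq̃·x}` with its physical momentum
`q̃ ∈ (−πN, πN]^d` (King's `m = 0` pairing of alias classes), inverse Fourier transform on the
`η/R`-lattice — band-limited (trigonometric) interpolation. OUR inter-lattice comparison convention.
[cite: King1986, (4.19) p.672 (the `m = 0` identification); Balaban1984PropagatorsI, (1.29) p.23] [folklore] -/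
def Jmat : Matrix (Tor (fine (R * N) M) × Fin d) (Tor (fine N M) × Fin d) ℂ :=
  star (dftV (fine (R * N) M)) * Jhat N R M * dftV (fine N M)

/-- `J_Rᴴ J_R = 1`: the two-level injection is an isometry. [folklore] -/
theorem Jmat_isometry (hN : 1 ≤ N) : (Jmat N R M)ᴴ * Jmat N R M = 1 := by
  unfold Jmat Jhat
  exact planted_isometry (star_dftV_mul _) (dftV_mul_star _) (blockEquiv N M) (blockEquiv (R * N) M) _
    (fun q => Pmat_conjTranspose_mul_self hN (abs_sOf_le M q))

/-- the constant of the torus η-rate: the fibrewise constant `Cop d a` of `B5G183RateOp.opNorm_G_rate`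
(cosets `p′ ≠ 0`) against the zero-coset constant `Czr = π²/24 + 1/4`. [folklore] -/
def CT (d : ℕ) (a : ℝ) : ℝ := max (Cop d a) Czr

omit [NeZero N] [NeZero R] hM in
/-- `0 ≤ CT`. [folklore] -/
theorem CT_nonneg (d : ℕ) (a : ℝ) : 0 ≤ CT d a := le_trans Czr_nonneg (le_max_right _ _)

/-- **blockwise η-rate over EVERY coset** of the unit torus: `p′ ≠ 0` by gen-3's fibrewise
`B5G183RateOp.opNorm_G_rate` (`Cop/N`), `p′ = 0` by `opNorm_zeroFib_rate` (`Czr/N²`). [folklore] -/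
theorem blocks_rate (hN : 1 ≤ N) (hR : 1 ≤ R) (hRN : 1 ≤ R * N) (a : ℝ) (ha : 0 < a) (q : Tor M) :
    ‖blocks (R * N) hRN M a ha q
        - Pmat N R (sOf M q) * blocks N hN M a ha q * (Pmat N R (sOf M q))ᴴ‖ ≤ CT d a / N := by
  have hN0 : (0 : ℝ) < N := by exact_mod_cast hN
  by_cases hq : q = 0
  · subst hq
    unfold blocks
    rw [dif_pos rfl, dif_pos rfl, sOf_zero]
    calc _ ≤ Czr * ((N : ℝ) ^ 2)⁻¹ := opNorm_zeroFib_rate hN hR a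
      _ ≤ Czr / N := by
          rw [div_eq_mul_inv]
          refine mul_le_mul_of_nonneg_left ?_ Czr_nonneg
          refine inv_anti₀ hN0 ?_
          have hN1 : (1 : ℝ) ≤ N := by exact_mod_cast hN
          nlinarith
      _ ≤ CT d a / N := div_le_div_of_nonneg_right (le_max_right _ _) hN0.le
  · unfold blocks
    rw [dif_neg hq, dif_neg hq, ← plant_eq_conj hN (abs_sOf_le M q)]
    exact (opNorm_G_rate hN hR hRN a ha (abs_sOf_le M q) (sOf_ne_zero M hq)).trans
      (div_le_div_of_nonneg_right (le_max_left _ _) hN0.le)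

/-- **THE TORUS OPERATOR-NORM η-RATE OF BAŁABAN'S `𝒢 = Δ_a⁻¹` AT `U = 1`.**  For every dimension `d`,
every unit torus (`M_μ ≥ 1` unit sites per direction), every `N ≥ 1` (`η = 1/N`), every refinement
factor `R ≥ 1` and every `a > 0`:
`‖𝒢^{(η/R)} − J_R 𝒢^{(η)} J_Rᴴ‖_{ℓ²(T_{η/R}; ℂ^d)} ≤ CT(d,a)·η`,
where `𝒢^{(η)} = B5Prop11Plancherel.calG N …` is THE operator on `ℓ²(T_η; ℂ^d)` whose Fourier blocks
over the cosets `p = p′ + l` are Bałaban's matrices (1.83) (b05), and `J_R` is the two-level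
band-limited injection `Jmat`.  Companion uniform bound (b05, the kernel version of (1.89)):
`‖𝒢^{(η)}‖ ≤ Cst d a` (`B5Prop11Plancherel.opNorm_calG_le`).  Bałaban prints NO rate in `η`; the rate,
the comparison convention and the constant are OURS (King's scalar mechanism (4.19)–(4.23), (4.31)
transferred to the vector layer).
[cite: Balaban1984PropagatorsI, (1.83) p.31, Prop. 1.1 (1.89) p.33; King1986, (4.19)-(4.23) p.672, (4.31) p.673] [folklore] -/
theorem opNorm_calG_rate (hN : 1 ≤ N) (hR : 1 ≤ R) (hRN : 1 ≤ R * N) (a : ℝ) (ha : 0 < a) :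
    ‖calG (R * N) hRN M a ha - Jmat N R M * calG N hN M a ha * (Jmat N R M)ᴴ‖ ≤ CT d a / N := by
  unfold calG calGhat Jmat Jhat
  exact opNorm_diff_planted_le (dftV_mul_star _) (dftV_mem_unitaryGroup _) (blockEquiv N M)
    (blockEquiv (R * N) M) _ _ _ (div_nonneg (CT_nonneg d a) (Nat.cast_nonneg N))
    (blocks_rate N R M hN hR hRN a ha)

/-- the same with `1 ≤ R·N` discharged. [folklore] -/
theorem opNorm_calG_rate' (hN : 1 ≤ N) (hR : 1 ≤ R) (a : ℝ) (ha : 0 < a) :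
    ‖calG (R * N) (le_trans hN (Nat.le_mul_of_pos_left N hR)) M a ha
        - Jmat N R M * calG N hN M a ha * (Jmat N R M)ᴴ‖ ≤ CT d a / N :=
  opNorm_calG_rate N R M hN hR _ a ha

/-- **compression form**: `‖J_Rᴴ 𝒢^{(η/R)} J_R − 𝒢^{(η)}‖_{ℓ²(T_η; ℂ^d)} ≤ CT(d,a)·η` — the fine-lattice
operator read on the band-limited functions IS the coarse-lattice operator up to `O(η)`. [folklore] -/
theorem opNorm_calG_rate_compression (hN : 1 ≤ N) (hR : 1 ≤ R) (hRN : 1 ≤ R * N) (a : ℝ) (ha : 0 < a) :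
    ‖(Jmat N R M)ᴴ * calG (R * N) hRN M a ha * Jmat N R M - calG N hN M a ha‖ ≤ CT d a / N :=
  opNorm_compression_le (Jmat_isometry N R M hN) _ _ (opNorm_calG_rate N R M hN hR hRN a ha)

/-- **uniform bound AND rate, side by side, on the lattice Hilbert space** (the η-rate linear theory of
`𝒢` at `U = 1`, operator form): `‖𝒢^{(η)}‖ ≤ Cst d a` (b05) and
`‖𝒢^{(η/R)} − J_R 𝒢^{(η)} J_Rᴴ‖ ≤ CT(d,a)·η` (this module), for all unit tori, all `N, R ≥ 1`, `a > 0`.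
[cite: Balaban1984PropagatorsI, Prop. 1.1 (1.89) p.33; King1986, (4.19)-(4.23) p.672, (4.31) p.673] [folklore] -/
theorem opNorm_calG_le_and_rate (hN : 1 ≤ N) (hR : 1 ≤ R) (hRN : 1 ≤ R * N) (a : ℝ) (ha : 0 < a) :
    ‖calG N hN M a ha‖ ≤ Cst d a
      ∧ ‖calG (R * N) hRN M a ha - Jmat N R M * calG N hN M a ha * (Jmat N R M)ᴴ‖ ≤ CT d a / N :=
  ⟨opNorm_calG_le N hN M a ha, opNorm_calG_rate N R M hN hR hRN a ha⟩

end Torus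

/-! ## §5 The first-order items `∇_ν𝒢`, `𝒢∇_ν^*` of (1.89) on the torus: η-rate from the fibrewise
first-order currencies of `B5G183RateL2Asm` (`p′ ≠ 0`) and a first-order zero coset [folklore] -/

section FirstOrderZero

variable {N R : ℕ} [NeZero N] [NeZero R]

/-- `∂^{(n)}_ν(0) = 0`: the order-one weight kills the constant mode. [folklore] -/
theorem dSym_const_zero {n : ℕ} [NeZero n] (ν : Fin d) :
    dSym n (fun _ => (0 : Fin n)) (0 : Fin d → ℝ) ν = 0 := by
  unfold dSym shiftr
  simp

/-- off-diagonal entries of `D_w G₀ D_1^*` vanish. [folklore] -/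
theorem sandwichL_zeroFib_apply_ne {n : ℕ} [NeZero n] (w : (Fin d → Fin n) → ℂ) (a : ℝ)
    {i j : (Fin d → Fin n) × Fin d} (h : i ≠ j) :
    sandwich w (fun _ => (1 : ℂ)) (zeroFib (d := d) n a) i j = 0 := by
  unfold sandwich
  rw [zeroFib_apply_ne a h, mul_zero, zero_mul]

/-- diagonal entries of `D_w G₀ D_1^*`. [folklore] -/
theorem sandwichL_zeroFib_apply_eq {n : ℕ} [NeZero n] (w : (Fin d → Fin n) → ℂ) (a : ℝ)
    (i : (Fin d → Fin n) × Fin d) :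
    sandwich w (fun _ => (1 : ℂ)) (zeroFib (d := d) n a) i i = w i.1 * zeroFib (d := d) n a i i := by
  unfold sandwich
  rw [map_one, mul_one]

/-- `D_1 G₀ D_w^* = (D_w G₀ D_1^*)ᴴ` (the zero fibre is a REAL diagonal matrix). [folklore] -/
theorem sandwichR_zeroFib_eq_conjTranspose {n : ℕ} [NeZero n] (w : (Fin d → Fin n) → ℂ) (a : ℝ) :
    sandwich (fun _ => (1 : ℂ)) w (zeroFib (d := d) n a)
      = (sandwich w (fun _ => (1 : ℂ)) (zeroFib (d := d) n a))ᴴ := by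
  ext i j
  rw [Matrix.conjTranspose_apply]
  unfold sandwich
  rw [map_one, mul_one, one_mul, star_mul', Complex.star_def, mul_comm]
  congr 1
  by_cases h : i = j
  · subst h
    rw [zeroFib_apply_eq]
    split_ifs
    · rw [map_div₀, map_one, Complex.conj_ofReal]
    · rw [map_div₀, map_one, Complex.conj_ofReal]
  · rw [zeroFib_apply_ne a h, zeroFib_apply_ne a (Ne.symm h), map_zero]

/-- **PAIRED first-order diagonal at `p′ = 0`, `k ≠ 0`** (the sibling `B5G183RateL2Op.diag_weight_rate_le`
assumes `p′ ≠ 0`; same mechanism: `‖∂^{(RN)} − ∂^{(N)}‖ ≤ 6‖q̃‖²/N` against `Δ⁻¹ ≤ π²/(4‖q̃‖²)`, and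
`‖∂^{(N)}‖ ≤ ‖q̃‖ ≤ πN` against King's (4.31)): `≤ Cdg/N`. [cite: King1986, (4.24), (4.29)-(4.31) p.673]
[folklore] -/
theorem diag_weight_rate_le_zero (hN : 1 ≤ N) (hR : 1 ≤ R) {k : Fin d → Fin N} (hk : k ≠ 0) (ν : Fin d) :
    ‖dSym (R * N) (iota R k 0) 0 ν * ((DeltaXir (R * N) 0 (symmAlias N k 0) : ℝ) : ℂ)⁻¹
        - dSym N k 0 ν * ((DeltaXir N 0 (symmAlias N k 0) : ℝ) : ℂ)⁻¹‖ ≤ Cdg / N := by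
  have hπ := Real.pi_pos
  have hN0 : (0 : ℝ) < N := by exact_mod_cast hN
  have hRN : 1 ≤ R * N := one_le_RN hN hR
  have hs := abs_zero_le_pi (d := d)
  set q := symmAlias N k (0 : Fin d → ℝ) with hqdef
  have hpos : 0 < momSq q := momSq_symmAlias_zero_pos hk
  have hzN : ∀ μ, |q μ| ≤ Real.pi * N := fun μ => symmAlias_abs_le hN k hs μ
  have hzR : ∀ μ, |q μ| ≤ Real.pi * ((R * N : ℕ) : ℝ) := by
    intro μ
    refine (hzN μ).trans ?_
    have : (N : ℝ) ≤ ((R * N : ℕ) : ℝ) := by exact_mod_cast Nat.le_mul_of_pos_left N hR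
    exact mul_le_mul_of_nonneg_left this hπ.le
  have hw : ‖dSym (R * N) (iota R k 0) 0 ν - dSym N k 0 ν‖ ≤ 6 * ‖q‖ ^ 2 / N :=
    dSym_rate_le hN hR k hs ν
  have hwN : ‖dSym N k 0 ν‖ ≤ ‖q‖ := norm_dSym_le hN k 0 ν
  have hqN : ‖q‖ ≤ Real.pi * N := norm_symmAlias_le hN k hs
  have ha : ‖q‖ ^ 2 * (DeltaXir (R * N) 0 q)⁻¹ ≤ Real.pi ^ 2 / 4 :=
    norm_sq_mul_inv_DeltaXir_le hRN hzR hpos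
  have hapos : 0 < (DeltaXir (R * N) 0 q)⁻¹ :=
    inv_pos.mpr (lt_of_lt_of_le (by positivity) (DeltaXir_ge_momSq hRN hzR))
  have hab : |(DeltaXir (R * N) 0 q)⁻¹ - (DeltaXir N 0 q)⁻¹| ≤ Real.pi ^ 2 / 24 * ((N : ℝ) ^ 2)⁻¹ := by
    rw [abs_sub_comm]; exact inv_DeltaXir_sub_abs hN hR hzN hpos
  rw [← Complex.ofReal_inv, ← Complex.ofReal_inv]
  refine (norm_mul_ofReal_sub_le _ _ _ _).trans ?_
  rw [abs_of_pos hapos]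
  have t1 : ‖dSym (R * N) (iota R k 0) 0 ν - dSym N k 0 ν‖ * (DeltaXir (R * N) 0 q)⁻¹
      ≤ 6 / N * (Real.pi ^ 2 / 4) := by
    calc ‖dSym (R * N) (iota R k 0) 0 ν - dSym N k 0 ν‖ * (DeltaXir (R * N) 0 q)⁻¹
        ≤ 6 * ‖q‖ ^ 2 / N * (DeltaXir (R * N) 0 q)⁻¹ := mul_le_mul_of_nonneg_right hw hapos.le
      _ = 6 / N * (‖q‖ ^ 2 * (DeltaXir (R * N) 0 q)⁻¹) := by ring
      _ ≤ 6 / N * (Real.pi ^ 2 / 4) := mul_le_mul_of_nonneg_left ha (by positivity)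
  have t2 : ‖dSym N k 0 ν‖ * |(DeltaXir (R * N) 0 q)⁻¹ - (DeltaXir N 0 q)⁻¹|
      ≤ Real.pi * N * (Real.pi ^ 2 / 24 * ((N : ℝ) ^ 2)⁻¹) :=
    mul_le_mul (hwN.trans hqN) hab (abs_nonneg _) (by positivity)
  calc ‖dSym (R * N) (iota R k 0) 0 ν - dSym N k 0 ν‖ * (DeltaXir (R * N) 0 q)⁻¹
        + ‖dSym N k 0 ν‖ * |(DeltaXir (R * N) 0 q)⁻¹ - (DeltaXir N 0 q)⁻¹|
      ≤ 6 / N * (Real.pi ^ 2 / 4) + Real.pi * N * (Real.pi ^ 2 / 24 * ((N : ℝ) ^ 2)⁻¹) :=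
        add_le_add t1 t2
    _ = Cdg / N := by unfold Cdg; field_simp; ring

/-- the first-order zero-coset constant: paired `Cdg` plus unpaired `π/4`. [folklore] -/
def CzrL : ℝ := Cdg + Real.pi / 4

/-- `0 ≤ CzrL`. [folklore] -/
theorem CzrL_nonneg : 0 ≤ CzrL := by
  unfold CzrL; exact add_nonneg Cdg_nonneg (by positivity)

/-- **the first-order η-rate of the zero coset, LEFT weight** (`∇_ν 𝒢` at `p′ = 0`):
`‖D_{∂^{(RN)}} G₀^{(RN)} − P (D_{∂^{(N)}} G₀^{(N)}) Pᴴ‖ ≤ (Cdg + π/4)/N`. [cite: Balaban1984PropagatorsI,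
(1.83) p.31, Prop. 1.1 (1.89) p.33; King1986, (4.23) p.672, (4.24), (4.31) p.673] [folklore] -/
theorem opNorm_zeroFibL_rate (hN : 1 ≤ N) (hR : 1 ≤ R) (a : ℝ) (ν : Fin d) :
    ‖sandwich (fun k => dSym (R * N) k (0 : Fin d → ℝ) ν) (fun _ => (1 : ℂ)) (zeroFib (d := d) (R * N) a)
        - Pmat N R (0 : Fin d → ℝ)
          * sandwich (fun k => dSym N k (0 : Fin d → ℝ) ν) (fun _ => (1 : ℂ)) (zeroFib (d := d) N a)
          * (Pmat N R (0 : Fin d → ℝ))ᴴ‖ ≤ CzrL / N := by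
  have hs := abs_zero_le_pi (d := d)
  have hN0 : N ≠ 0 := by omega
  have hN0' : (0 : ℝ) < N := by exact_mod_cast hN
  have hRN0 : R * N ≠ 0 := Nat.mul_ne_zero (by omega) hN0
  have hπ := Real.pi_pos
  have hC : 0 ≤ CzrL / N := div_nonneg CzrL_nonneg hN0'.le
  rw [← plant_eq_conj hN hs]
  refine opNorm_le_of_offDiag_eq_zero _ hC ?_ ?_
  · rintro ⟨i1, μ⟩ ⟨i1', μ'⟩ hne
    rw [Matrix.sub_apply, sandwichL_zeroFib_apply_ne _ _ hne]
    by_cases hi : ∃ k : Fin d → Fin N, iota R k 0 = i1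
    · obtain ⟨k, rfl⟩ := hi
      by_cases hi' : ∃ k' : Fin d → Fin N, iota R k' 0 = i1'
      · obtain ⟨k', rfl⟩ := hi'
        rw [plant_iota_iota hN hs, sandwichL_zeroFib_apply_ne, sub_zero]
        intro h
        rw [Prod.mk.injEq] at h
        exact hne (by rw [h.1, h.2])
      · push Not at hi'
        rw [plant_col_unpaired _ _ hi', sub_zero]
    · push Not at hi
      rw [plant_row_unpaired _ hi, sub_zero]
  · rintro ⟨i1, μ⟩
    rw [Matrix.sub_apply]
    by_cases hi : ∃ k : Fin d → Fin N, iota R k 0 = i1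
    · obtain ⟨k, rfl⟩ := hi
      rw [plant_iota_iota hN hs, sandwichL_zeroFib_apply_eq, sandwichL_zeroFib_apply_eq,
        zeroFib_apply_eq, zeroFib_apply_eq]
      dsimp only
      by_cases hk : k = 0
      · subst hk
        have h1 : iota R (0 : Fin d → Fin N) (0 : Fin d → ℝ) = fun _ => 0 := iota_zero hN hs
        have h2 : (0 : Fin d → Fin N) = fun _ => 0 := rfl
        rw [h1, dSym_const_zero, zero_mul, h2, dSym_const_zero, zero_mul, sub_self, norm_zero]
        exact hC
      · have hι : ¬ iota R k (0 : Fin d → ℝ) = fun _ => 0 := fun h => hk ((iota_eq_zero_iff hN hs k).mp h)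
        have hk' : ¬ k = fun _ => 0 := hk
        rw [if_neg hι, if_neg hk']
        have e1 : DeltaXir (R * N) 0 (shiftr (R * N) (iota R k 0) 0) = DeltaXir (R * N) 0 (symmAlias N k 0) := by
          rw [← DeltaXir_symmAlias hRN0, symmAlias_iota hN k hs]
        have e2 : DeltaXir N 0 (shiftr N k 0) = DeltaXir N 0 (symmAlias N k 0) := by
          rw [← DeltaXir_symmAlias hN0]
        rw [e1, e2, one_div, one_div]
        calc _ ≤ Cdg / N := diag_weight_rate_le_zero hN hR hk ν
          _ ≤ CzrL / N := by
              refine div_le_div_of_nonneg_right ?_ hN0'.le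
              unfold CzrL; linarith
    · push Not at hi
      rw [plant_row_unpaired _ hi, sub_zero, sandwichL_zeroFib_apply_eq, zeroFib_apply_eq]
      dsimp only
      have hi0 : ¬ i1 = fun _ => 0 := by
        intro h
        exact hi 0 ((iota_zero hN hs).trans h.symm)
      rw [if_neg hi0]
      have e1 : DeltaXir (R * N) 0 (shiftr (R * N) i1 0) = DeltaXir (R * N) 0 (symmAlias (R * N) i1 0) := by
        rw [← DeltaXir_symmAlias hRN0]
      rw [e1, one_div]
      calc _ ≤ Real.pi / (4 * N) := diag_weight_unpaired_le hN hR hs hi ν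
        _ = Real.pi / 4 / N := by rw [div_div]
        _ ≤ CzrL / N := by
            refine div_le_div_of_nonneg_right ?_ hN0'.le
            unfold CzrL; linarith [Cdg_nonneg]

/-- **the first-order η-rate of the zero coset, RIGHT weight** (`𝒢 ∇_ν^*` at `p′ = 0`) — the adjoint of
the left-weight statement. [folklore] -/
theorem opNorm_zeroFibR_rate (hN : 1 ≤ N) (hR : 1 ≤ R) (a : ℝ) (ν : Fin d) :
    ‖sandwich (fun _ => (1 : ℂ)) (fun k => dSym (R * N) k (0 : Fin d → ℝ) ν) (zeroFib (d := d) (R * N) a)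
        - Pmat N R (0 : Fin d → ℝ)
          * sandwich (fun _ => (1 : ℂ)) (fun k => dSym N k (0 : Fin d → ℝ) ν) (zeroFib (d := d) N a)
          * (Pmat N R (0 : Fin d → ℝ))ᴴ‖ ≤ CzrL / N := by
  rw [sandwichR_zeroFib_eq_conjTranspose, sandwichR_zeroFib_eq_conjTranspose]
  set P := Pmat N R (0 : Fin d → ℝ)
  set X' := sandwich (fun k => dSym (R * N) k (0 : Fin d → ℝ) ν) (fun _ => (1 : ℂ)) (zeroFib (d := d) (R * N) a)
  set X := sandwich (fun k => dSym N k (0 : Fin d → ℝ) ν) (fun _ => (1 : ℂ)) (zeroFib (d := d) N a)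
  have e : X'ᴴ - P * Xᴴ * Pᴴ = (X' - P * X * Pᴴ)ᴴ := by
    rw [Matrix.conjTranspose_sub, Matrix.conjTranspose_mul, Matrix.conjTranspose_mul,
      Matrix.conjTranspose_conjTranspose, Matrix.mul_assoc]
  rw [e, Matrix.l2_opNorm_conjTranspose]
  exact opNorm_zeroFibL_rate hN hR a ν

end FirstOrderZero

section FirstOrderTorus

variable (N R : ℕ) [NeZero N] [NeZero R] (M : Fin d → ℕ) [hM : ∀ μ, NeZero (M μ)]

omit [NeZero N] [NeZero R] in
/-- `mulW W₁ W₂ = F^* (⊕_q D_{w₁(q)} G(q) D_{w₂(q)}^*) F` along the cosets (b05's `reindex_conj_mulW`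
conjugated back). [folklore] -/
theorem mulW_eq_conj_blocks {n : ℕ} [NeZero n] (hn : 1 ≤ n) (a : ℝ) (ha : 0 < a)
    (W₁ W₂ : Tor (fine n M) × Fin d → ℂ) (w₁ w₂ : Tor M → (Fin d → Fin n) → ℂ)
    (e₁ : ∀ I, W₁ ((blockEquiv n M).symm I) = w₁ I.2 I.1.1)
    (e₂ : ∀ I, W₂ ((blockEquiv n M).symm I) = w₂ I.2 I.1.1) :
    mulW n hn M a ha W₁ W₂
      = star (dftV (fine n M)) * (Matrix.reindex (blockEquiv n M) (blockEquiv n M)).symm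
          (Matrix.blockDiagonal fun q => sandwich (w₁ q) (w₂ q) (blocks n hn M a ha q)) * dftV (fine n M) := by
  have h := reindex_conj_mulW n hn M a ha W₁ W₂ w₁ w₂ e₁ e₂
  have h2 : dftV (fine n M) * mulW n hn M a ha W₁ W₂ * star (dftV (fine n M))
      = (Matrix.reindex (blockEquiv n M) (blockEquiv n M)).symm
          (Matrix.blockDiagonal fun q => sandwich (w₁ q) (w₂ q) (blocks n hn M a ha q)) := by
    rw [← h, Equiv.symm_apply_apply]
  have hU := star_dftV_mul (fine n M)
  set U := dftV (fine n M)
  calc mulW n hn M a ha W₁ W₂ = (star U * U) * mulW n hn M a ha W₁ W₂ * (star U * U) := by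
        rw [hU, Matrix.one_mul, Matrix.mul_one]
    _ = star U * (U * mulW n hn M a ha W₁ W₂ * star U) * U := by simp only [Matrix.mul_assoc]
    _ = _ := by rw [h2]

/-- the constant of the first-order torus η-rate: fibrewise `Casm d a` (`B5G183RateL2Asm`, `p′ ≠ 0`)
against the zero-coset `CzrL`. [folklore] -/
def CTL (d : ℕ) (a : ℝ) : ℝ := max (Casm d a) CzrL

omit [NeZero N] [NeZero R] hM in
/-- `0 ≤ CTL`. [folklore] -/
theorem CTL_nonneg (d : ℕ) (a : ℝ) : 0 ≤ CTL d a := le_trans CzrL_nonneg (le_max_right _ _)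

/-- blockwise first-order rate, LEFT weight, over every coset. [folklore] -/
theorem blocksL_rate (hN : 1 ≤ N) (hR : 1 ≤ R) (hRN : 1 ≤ R * N) (a : ℝ) (ha : 0 < a) (ν : Fin d)
    (q : Tor M) :
    ‖sandwich (fun k => dSym (R * N) k (sOf M q) ν) (fun _ => (1 : ℂ)) (blocks (R * N) hRN M a ha q)
        - Pmat N R (sOf M q)
          * sandwich (fun k => dSym N k (sOf M q) ν) (fun _ => (1 : ℂ)) (blocks N hN M a ha q)
          * (Pmat N R (sOf M q))ᴴ‖ ≤ CTL d a / N := by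
  have hN0 : (0 : ℝ) < N := by exact_mod_cast hN
  by_cases hq : q = 0
  · subst hq
    unfold blocks
    rw [dif_pos rfl, dif_pos rfl, sOf_zero]
    exact (opNorm_zeroFibL_rate hN hR a ν).trans (div_le_div_of_nonneg_right (le_max_right _ _) hN0.le)
  · unfold blocks
    rw [dif_neg hq, dif_neg hq, ← plant_eq_conj hN (abs_sOf_le M q)]
    exact (orderOneOpRateResidualL_holds d a N R hN hRN ha (sOf M q) (abs_sOf_le M q) (sOf_ne_zero M hq)
      ν hR).trans (div_le_div_of_nonneg_right (le_max_left _ _) hN0.le)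

/-- blockwise first-order rate, RIGHT weight, over every coset. [folklore] -/
theorem blocksR_rate (hN : 1 ≤ N) (hR : 1 ≤ R) (hRN : 1 ≤ R * N) (a : ℝ) (ha : 0 < a) (ν : Fin d)
    (q : Tor M) :
    ‖sandwich (fun _ => (1 : ℂ)) (fun k => dSym (R * N) k (sOf M q) ν) (blocks (R * N) hRN M a ha q)
        - Pmat N R (sOf M q)
          * sandwich (fun _ => (1 : ℂ)) (fun k => dSym N k (sOf M q) ν) (blocks N hN M a ha q)
          * (Pmat N R (sOf M q))ᴴ‖ ≤ CTL d a / N := by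
  have hN0 : (0 : ℝ) < N := by exact_mod_cast hN
  by_cases hq : q = 0
  · subst hq
    unfold blocks
    rw [dif_pos rfl, dif_pos rfl, sOf_zero]
    exact (opNorm_zeroFibR_rate hN hR a ν).trans (div_le_div_of_nonneg_right (le_max_right _ _) hN0.le)
  · unfold blocks
    rw [dif_neg hq, dif_neg hq, ← plant_eq_conj hN (abs_sOf_le M q)]
    exact (orderOneOpRateResidualR_holds d a N R hN hRN ha (sOf M q) (abs_sOf_le M q) (sOf_ne_zero M hq)
      ν hR).trans (div_le_div_of_nonneg_right (le_max_left _ _) hN0.le)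

omit [NeZero N] [NeZero R] in
/-- the symbol of `∇_ν` restricts to the cosets as `∂_ν(p′ + l)` (b05's `fsym_emb`, bookkeeping form).
[folklore] -/
theorem fsym_mul_one_restrict {n : ℕ} [NeZero n] (ν : Fin d) (I : ((Fin d → Fin n) × Fin d) × Tor M) :
    (fun i => fsym (fine n M) (n : ℂ) ν i * (1 : ℂ)) ((blockEquiv n M).symm I)
      = dSym n I.1.1 (sOf M I.2) ν := by
  obtain ⟨⟨k, μ⟩, q⟩ := I
  rw [blockEquiv_symm_apply]
  dsimp only
  rw [mul_one]
  exact fsym_emb n M k μ q ν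

omit [NeZero N] [NeZero R] in
/-- (right weight) `1 · fsym` restricts likewise. [folklore] -/
theorem one_mul_fsym_restrict {n : ℕ} [NeZero n] (ν : Fin d) (I : ((Fin d → Fin n) × Fin d) × Tor M) :
    (fun i => (1 : ℂ) * fsym (fine n M) (n : ℂ) ν i) ((blockEquiv n M).symm I)
      = dSym n I.1.1 (sOf M I.2) ν := by
  obtain ⟨⟨k, μ⟩, q⟩ := I
  rw [blockEquiv_symm_apply]
  dsimp only
  rw [one_mul]
  exact fsym_emb n M k μ q ν

/-- **THE TORUS η-RATE OF `∇_ν 𝒢`** (the second item of (1.89), `U = 1`):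
`‖∇_ν^{(η/R)} 𝒢^{(η/R)} − J_R (∇_ν^{(η)} 𝒢^{(η)}) J_Rᴴ‖ ≤ CTL(d,a)·η` for every unit torus, `N, R ≥ 1`,
`a > 0`, `ν`.  The `p′ ≠ 0` cosets are EXACTLY the kernel theorem
`B5G183RateL2Asm.orderOneOpRateResidualL_holds` (`Casm/N`), the `p′ = 0` coset is `opNorm_zeroFibL_rate`.
[cite: Balaban1984PropagatorsI, Prop. 1.1 (1.89) p.33; King1986, (4.19)-(4.23) p.672, (4.24), (4.29)-(4.31) p.673]
[folklore] -/
theorem opNorm_fdiff_calG_rate (hN : 1 ≤ N) (hR : 1 ≤ R) (hRN : 1 ≤ R * N) (a : ℝ) (ha : 0 < a)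
    (ν : Fin d) :
    ‖fdiff (fine (R * N) M) ((R * N : ℕ) : ℂ) ν * calG (R * N) hRN M a ha
        - Jmat N R M * (fdiff (fine N M) (N : ℂ) ν * calG N hN M a ha) * (Jmat N R M)ᴴ‖
      ≤ CTL d a / N := by
  rw [calG_eq_mulW, calG_eq_mulW, fdiff_mul_mulW, fdiff_mul_mulW,
    mulW_eq_conj_blocks M hRN a ha _ _ (fun q k => dSym (R * N) k (sOf M q) ν) (fun _ _ => (1 : ℂ))
      (fsym_mul_one_restrict M ν) (fun _ => rfl),
    mulW_eq_conj_blocks M hN a ha _ _ (fun q k => dSym N k (sOf M q) ν) (fun _ _ => (1 : ℂ))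
      (fsym_mul_one_restrict M ν) (fun _ => rfl)]
  unfold Jmat Jhat
  exact opNorm_diff_planted_le (dftV_mul_star _) (dftV_mem_unitaryGroup _) (blockEquiv N M)
    (blockEquiv (R * N) M) _ _ _ (div_nonneg (CTL_nonneg d a) (Nat.cast_nonneg N))
    (blocksL_rate N R M hN hR hRN a ha ν)

/-- **THE TORUS η-RATE OF `𝒢 ∇_ν^*`** (the third item of (1.89), `U = 1`):
`‖𝒢^{(η/R)} ∇_ν^{(η/R)*} − J_R (𝒢^{(η)} ∇_ν^{(η)*}) J_Rᴴ‖ ≤ CTL(d,a)·η`; `p′ ≠ 0` by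
`B5G183RateL2Asm.orderOneOpRateResidualR_holds`, `p′ = 0` by `opNorm_zeroFibR_rate`.
[cite: Balaban1984PropagatorsI, Prop. 1.1 (1.89) p.33; King1986, (4.19)-(4.23) p.672, (4.24), (4.29)-(4.31) p.673]
[folklore] -/
theorem opNorm_calG_star_fdiff_rate (hN : 1 ≤ N) (hR : 1 ≤ R) (hRN : 1 ≤ R * N) (a : ℝ) (ha : 0 < a)
    (ν : Fin d) :
    ‖calG (R * N) hRN M a ha * star (fdiff (fine (R * N) M) ((R * N : ℕ) : ℂ) ν)
        - Jmat N R M * (calG N hN M a ha * star (fdiff (fine N M) (N : ℂ) ν)) * (Jmat N R M)ᴴ‖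
      ≤ CTL d a / N := by
  rw [calG_eq_mulW, calG_eq_mulW, mulW_mul_star_fdiff, mulW_mul_star_fdiff,
    mulW_eq_conj_blocks M hRN a ha _ _ (fun _ _ => (1 : ℂ)) (fun q k => dSym (R * N) k (sOf M q) ν)
      (fun _ => rfl) (one_mul_fsym_restrict M ν),
    mulW_eq_conj_blocks M hN a ha _ _ (fun _ _ => (1 : ℂ)) (fun q k => dSym N k (sOf M q) ν)
      (fun _ => rfl) (one_mul_fsym_restrict M ν)]
  unfold Jmat Jhat
  exact opNorm_diff_planted_le (dftV_mul_star _) (dftV_mem_unitaryGroup _) (blockEquiv N M)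
    (blockEquiv (R * N) M) _ _ _ (div_nonneg (CTL_nonneg d a) (Nat.cast_nonneg N))
    (blocksR_rate N R M hN hR hRN a ha ν)

/-- **uniform bounds AND rates for the three items `𝒢`, `∇_ν𝒢`, `𝒢∇_ν^*` of (1.89) at `U = 1`, on the
lattice Hilbert space** — uniform: b05 (`opNorm_calG_le`, `opNorm_fdiff_calG_le`,
`opNorm_calG_star_fdiff_le`, constant `Cst d a`); rates: this module (`CT`, `CTL`), currency `η = 1/N`
with no loss, no conditional. [cite: Balaban1984PropagatorsI, Prop. 1.1 (1.89) p.33] [folklore] -/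
theorem orderLeOne_uniform_and_rate (hN : 1 ≤ N) (hR : 1 ≤ R) (hRN : 1 ≤ R * N) (a : ℝ) (ha : 0 < a)
    (ν : Fin d) :
    (‖calG N hN M a ha‖ ≤ Cst d a
      ∧ ‖fdiff (fine N M) (N : ℂ) ν * calG N hN M a ha‖ ≤ Cst d a
      ∧ ‖calG N hN M a ha * star (fdiff (fine N M) (N : ℂ) ν)‖ ≤ Cst d a)
    ∧ (‖calG (R * N) hRN M a ha - Jmat N R M * calG N hN M a ha * (Jmat N R M)ᴴ‖ ≤ CT d a / N
      ∧ ‖fdiff (fine (R * N) M) ((R * N : ℕ) : ℂ) ν * calG (R * N) hRN M a ha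
          - Jmat N R M * (fdiff (fine N M) (N : ℂ) ν * calG N hN M a ha) * (Jmat N R M)ᴴ‖ ≤ CTL d a / N
      ∧ ‖calG (R * N) hRN M a ha * star (fdiff (fine (R * N) M) ((R * N : ℕ) : ℂ) ν)
          - Jmat N R M * (calG N hN M a ha * star (fdiff (fine N M) (N : ℂ) ν)) * (Jmat N R M)ᴴ‖
            ≤ CTL d a / N) :=
  ⟨⟨opNorm_calG_le N hN M a ha, opNorm_fdiff_calG_le N hN M a ha ν, opNorm_calG_star_fdiff_le N hN M a ha ν⟩,
    ⟨opNorm_calG_rate N R M hN hR hRN a ha, opNorm_fdiff_calG_rate N R M hN hR hRN a ha ν,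
      opNorm_calG_star_fdiff_rate N R M hN hR hRN a ha ν⟩⟩

end FirstOrderTorus

/-! ## §6. The coarse-point identity: `J_R = R^{-d/2}` × band-limited interpolation

On the coarse points `x ∈ T_η ⊂ T_{η/R}` every planted plane wave coincides with the original one (the
paired momenta `p′ + 2π ι_R k` and `p′ + 2πk` differ by a multiple of `2πN = 2π/η` in each coordinate), so
`(J_R f)(x) = R^{-d/2} f(x)` at every coarse point: with the SAMPLING operator `(Q g)(x) = g(x)|_{T_η}`,
`Q J_R = R^{-d/2}·1`.  Since the range of `J_R` is spanned by the planted plane waves (by construction),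
this identifies `J_R` as `R^{-d/2}` times the trigonometric (band-limited) interpolation from the
`η`-lattice to the `η/R`-lattice (the interpolation statement itself is not typed).  (King's `Q` of
[King1986] (2.10) p.653 (render king p005 read by this seat) is block AVERAGING, for which `Q J_R` is not a
multiple of the identity; it is not typed here.) -/

section Sampling

variable (N R : ℕ) [NeZero N] [NeZero R] (M : Fin d → ℕ) [hM : ∀ μ, NeZero (M μ)]

/-- the coarse site `x ∈ T_η` (site index `j_ν`, position `η j_ν`) as a site of `T_{η/R}` (index `R j_ν`,
position `(η/R)(R j_ν)`). [folklore] -/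
def cpt (x : Tor (fine N M)) : Tor (fine (R * N) M) :=
  fun ν => ((R * (x ν).val : ℕ) : ZMod (fine (R * N) M ν))

omit [NeZero N] [NeZero R] hM in
/-- two standard characters with exponents differing by an integer agree. [folklore] -/
theorem stdAddChar_intCast_eq {n₁ n₂ : ℕ} [NeZero n₁] [NeZero n₂] {A₁ A₂ : ℤ} (m : ℤ)
    (h : ((A₁ : ℤ) : ℂ) / (n₁ : ℂ) = ((A₂ : ℤ) : ℂ) / (n₂ : ℂ) + (m : ℂ)) :
    ZMod.stdAddChar (N := n₁) ((A₁ : ℤ) : ZMod n₁)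
      = ZMod.stdAddChar (N := n₂) ((A₂ : ℤ) : ZMod n₂) := by
  rw [ZMod.stdAddChar_coe, ZMod.stdAddChar_coe]
  have e : (2 * (Real.pi : ℂ) * I * ((A₁ : ℤ) : ℂ) / (n₁ : ℂ) : ℂ)
      = 2 * (Real.pi : ℂ) * I * ((A₂ : ℤ) : ℂ) / (n₂ : ℂ) + (m : ℂ) * (2 * (Real.pi : ℂ) * I) := by
    rw [mul_div_assoc, h]; ring
  rw [e, Complex.exp_add, Complex.exp_int_mul_two_pi_mul_I, mul_one]

omit [NeZero N] hM in
/-- `(ι_R k)_ν = k_ν + (RN − N)·χ_ν` as an identity in `ℂ` (`χ = King1986.symmShift ∈ {0,1}`):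
the paired index is congruent to `k` modulo `N`. [folklore] -/
theorem iota_cast (k : Fin d → Fin N) (s : Fin d → ℝ) (ν : Fin d) :
    (((iota R k s ν : Fin (R * N)) : ℕ) : ℂ)
      = ((k ν : ℕ) : ℂ) + ((R : ℂ) * N - N) * ((symmShift N k s ν : ℕ) : ℂ) := by
  have hRN : N ≤ R * N := Nat.le_mul_of_pos_left N (Nat.pos_of_ne_zero (NeZero.ne R))
  have h0 : ((iota R k s ν : Fin (R * N)) : ℕ) = (k ν : ℕ) + (R * N - N) * symmShift N k s ν := rfl
  rw [h0]; push_cast [Nat.cast_sub hRN]; ring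

/-- **per coordinate**: the character of the planted level-`RN` momentum `p′_ν + 2π(ι_R k)_ν` at the coarse
point `R j_ν` equals the character of the level-`N` momentum `p′_ν + 2πk_ν` at `j_ν` (valid for every
`p′`, no range hypothesis). [folklore] -/
theorem stdAddChar_emb_iota_cpt (k : Fin d → Fin N) (s : Fin d → ℝ) (μ : Fin d) (q : Tor M)
    (x : Tor (fine N M)) (ν : Fin d) :
    ZMod.stdAddChar (N := fine (R * N) M ν)
        ((B5Prop11Plancherel.emb (R * N) M ((iota R k s, μ), q)).1 ν * cpt N R M x ν)
      = ZMod.stdAddChar (N := fine N M ν)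
        ((B5Prop11Plancherel.emb N M ((k, μ), q)).1 ν * x ν) := by
  have hM0 : (M ν : ℂ) ≠ 0 := by exact_mod_cast NeZero.ne (M ν)
  have hN0 : (N : ℂ) ≠ 0 := by exact_mod_cast NeZero.ne N
  have hR0 : (R : ℂ) ≠ 0 := by exact_mod_cast NeZero.ne R
  have hx1 : (B5Prop11Plancherel.emb (R * N) M ((iota R k s, μ), q)).1 ν * cpt N R M x ν
      = ((((q ν).valMinAbs + (M ν : ℤ) * ((iota R k s ν : ℕ) : ℤ)) * ((R * (x ν).val : ℕ) : ℤ) : ℤ)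
          : ZMod (fine (R * N) M ν)) := by
    rw [Int.cast_mul, Int.cast_natCast]; rfl
  have hx2 : (B5Prop11Plancherel.emb N M ((k, μ), q)).1 ν * x ν
      = ((((q ν).valMinAbs + (M ν : ℤ) * ((k ν : ℕ) : ℤ)) * (((x ν).val : ℕ) : ℤ) : ℤ)
          : ZMod (fine N M ν)) := by
    rw [Int.cast_mul, Int.cast_natCast, ZMod.natCast_zmod_val]; rfl
  rw [hx1, hx2]
  refine stdAddChar_intCast_eq
    ((((x ν).val : ℕ) : ℤ) * ((R : ℤ) - 1) * ((symmShift N k s ν : ℕ) : ℤ)) ?_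
  simp only [fine]
  push_cast
  rw [iota_cast]
  field_simp
  ring

/-- the planted plane wave and the original plane wave AGREE ON THE COARSE POINTS:
`e^{i(p′ + 2πι_R k)·x} = e^{i(p′ + 2πk)·x}` for `x ∈ T_η`. [folklore] -/
theorem chi_emb_iota_cpt (k : Fin d → Fin N) (s : Fin d → ℝ) (μ : Fin d) (q : Tor M)
    (x : Tor (fine N M)) :
    chi (fine (R * N) M) (B5Prop11Plancherel.emb (R * N) M ((iota R k s, μ), q)).1 (cpt N R M x)
      = chi (fine N M) (B5Prop11Plancherel.emb N M ((k, μ), q)).1 x := by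
  unfold chi
  exact Finset.prod_congr rfl fun ν _ => stdAddChar_emb_iota_cpt N R M k s μ q x ν

omit [NeZero R] in
/-- `blockEquiv ∘ emb = id` (b05's coset parametrisation and its inverse). [folklore] -/
theorem blockEquiv_emb (n : ℕ) [NeZero n] (I : ((Fin d → Fin n) × Fin d) × Tor M) :
    blockEquiv n M (B5Prop11Plancherel.emb n M I) = I :=
  (blockEquiv n M).apply_symm_apply I

omit [NeZero R] in
/-- every (fine momentum, component) index is a coset point `emb I`. [folklore] -/
theorem exists_emb_eq (n : ℕ) [NeZero n] (P : Tor (fine n M) × Fin d) :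
    ∃ I, P = B5Prop11Plancherel.emb n M I :=
  ⟨blockEquiv n M P, ((blockEquiv n M).symm_apply_apply P).symm⟩

/-- entries of `Ĵ_R` against the coarse mode `p = p′(q) + 2πk` (component `μ`): a single `1`, at the
planted fine mode `p′(q) + 2π ι_R k` (component `μ`). [folklore] -/
theorem Jhat_apply_emb (P' : Tor (fine (R * N) M) × Fin d) (k : Fin d → Fin N) (μ : Fin d) (q : Tor M) :
    Jhat N R M P' (B5Prop11Plancherel.emb N M ((k, μ), q))
      = if P' = B5Prop11Plancherel.emb (R * N) M ((iota R k (sOf M q), μ), q) then 1 else 0 := by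
  obtain ⟨⟨ik', q'⟩, rfl⟩ := exists_emb_eq M (R * N) P'
  unfold Jhat
  rw [Matrix.reindex_apply, Matrix.submatrix_apply, Equiv.symm_symm, Equiv.symm_symm, blockEquiv_emb,
    blockEquiv_emb, Matrix.blockDiagonal_apply']
  by_cases hq : q' = q
  · have hiff : (B5Prop11Plancherel.emb (R * N) M (ik', q)
          = B5Prop11Plancherel.emb (R * N) M ((iota R k (sOf M q), μ), q))
        ↔ ik' = (iota R k (sOf M q), μ) := by
      rw [(B5Prop11Plancherel.emb_injective (R * N) M).eq_iff, Prod.mk.injEq]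
      exact ⟨fun h => h.1, fun h => ⟨h, rfl⟩⟩
    simp only [hq, if_true, hiff, Pmat]
  · have hne : B5Prop11Plancherel.emb (R * N) M (ik', q')
        ≠ B5Prop11Plancherel.emb (R * N) M ((iota R k (sOf M q), μ), q) :=
      fun h => hq (congrArg Prod.snd (B5Prop11Plancherel.emb_injective (R * N) M h))
    rw [if_neg hq, if_neg hne]

/-- **SAMPLING at the coarse points**: `(Q g)(x, μ) = g(R·x, μ)`, as a `0/1` matrix. [folklore] -/
def Smp : Matrix (Tor (fine N M) × Fin d) (Tor (fine (R * N) M) × Fin d) ℂ :=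
  fun i j => if j = (cpt N R M i.1, i.2) then 1 else 0

/-- rows of `Q X` are rows of `X` at coarse points. [folklore] -/
theorem Smp_mul_apply {β : Type*} (X : Matrix (Tor (fine (R * N) M) × Fin d) β ℂ)
    (i : Tor (fine N M) × Fin d) (j : β) :
    (Smp N R M * X) i j = X (cpt N R M i.1, i.2) j := by
  simp only [Matrix.mul_apply, Smp, boole_mul, Finset.sum_ite_eq', Finset.mem_univ, if_true]

/-- `(Q g)(x, μ) = g(R·x, μ)`. [folklore] -/
theorem Smp_mulVec_apply (g : Tor (fine (R * N) M) × Fin d → ℂ) (i : Tor (fine N M) × Fin d) :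
    (Smp N R M *ᵥ g) i = g (cpt N R M i.1, i.2) := by
  simp only [Matrix.mulVec, dotProduct, Smp, boole_mul, Finset.sum_ite_eq', Finset.mem_univ, if_true]

omit [NeZero R] in
/-- the component-diagonal DFT against a coset point. [folklore] -/
theorem dftV_emb_apply (n : ℕ) [NeZero n] (I : ((Fin d → Fin n) × Fin d) × Tor M)
    (y : Tor (fine n M)) (μ : Fin d) :
    dftV (fine n M) (B5Prop11Plancherel.emb n M I) (y, μ)
      = if I.1.2 = μ then dft (fine n M) (B5Prop11Plancherel.emb n M I).1 y else 0 :=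
  dftV_apply (fine n M) (B5Prop11Plancherel.emb n M I).1 I.1.2 y μ

omit [NeZero R] in
/-- `|T| > 0` as a real number, through the square root. [folklore] -/
theorem sqrt_card_ne_zero (n : ℕ) [NeZero n] :
    ((Real.sqrt (Fintype.card (Tor (fine n M))) : ℝ) : ℂ) ≠ 0 := by
  have h : (0 : ℝ) < Fintype.card (Tor (fine n M)) := by exact_mod_cast Fintype.card_pos
  exact_mod_cast (Real.sqrt_pos.mpr h).ne'

/-- **`Q F_{RN}^* Ĵ_R = (|T_η|/|T_{η/R}|)^{1/2} F_η^*`**: sampling the planted plane waves at the coarse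
points returns the coarse plane waves. [folklore] -/
theorem Smp_star_dftV_Jhat :
    Smp N R M * star (dftV (fine (R * N) M)) * Jhat N R M
      = (((Real.sqrt (Fintype.card (Tor (fine N M))) : ℝ) : ℂ)
          / ((Real.sqrt (Fintype.card (Tor (fine (R * N) M))) : ℝ) : ℂ)) • star (dftV (fine N M)) := by
  have hT := sqrt_card_ne_zero M N
  have hT' := sqrt_card_ne_zero M (R * N)
  ext ⟨x, μ⟩ P
  obtain ⟨⟨⟨k, μ'⟩, q⟩, rfl⟩ := exists_emb_eq M N P
  rw [Matrix.smul_apply, Matrix.mul_apply]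
  simp_rw [Jhat_apply_emb, mul_ite, mul_one, mul_zero, Finset.sum_ite_eq', Finset.mem_univ, if_true,
    Smp_mul_apply]
  rw [Matrix.star_eq_conjTranspose, Matrix.star_eq_conjTranspose, Matrix.conjTranspose_apply,
    Matrix.conjTranspose_apply, dftV_emb_apply, dftV_emb_apply]
  by_cases hμ : μ' = μ
  · simp only [hμ, if_true, smul_eq_mul]
    unfold dft
    rw [Complex.star_def, map_mul, map_mul, Complex.conj_conj, Complex.conj_conj, Complex.conj_ofReal,
      Complex.conj_ofReal, chi_emb_iota_cpt]
    push_cast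
    field_simp
  · simp only [hμ, if_false, star_zero, smul_zero]

/-- `|T_{η/R}| = R^d |T_η|`. [folklore] -/
theorem card_fine_mul : Fintype.card (Tor (fine (R * N) M)) = R ^ d * Fintype.card (Tor (fine N M)) := by
  simp only [Fintype.card_pi, ZMod.card, fine]
  simp_rw [Nat.mul_assoc]
  rw [Finset.prod_mul_distrib, Finset.prod_const, Finset.card_univ, Fintype.card_fin]

/-- `(|T_η|/|T_{η/R}|)^{1/2} = R^{-d/2}`. [folklore] -/
theorem sqrt_card_ratio :
    (((Real.sqrt (Fintype.card (Tor (fine N M))) : ℝ) : ℂ)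
        / ((Real.sqrt (Fintype.card (Tor (fine (R * N) M))) : ℝ) : ℂ))
      = (((Real.sqrt ((R : ℝ) ^ d))⁻¹ : ℝ) : ℂ) := by
  have hT := sqrt_card_ne_zero M N
  have hRd : (0 : ℝ) ≤ (R : ℝ) ^ d := by positivity
  have hRd' : ((Real.sqrt ((R : ℝ) ^ d) : ℝ) : ℂ) ≠ 0 := by
    have : (0 : ℝ) < (R : ℝ) ^ d := by
      have hR : (0 : ℝ) < R := by exact_mod_cast Nat.pos_of_ne_zero (NeZero.ne R)
      positivity
    exact_mod_cast (Real.sqrt_pos.mpr this).ne'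
  rw [card_fine_mul, Nat.cast_mul, Nat.cast_pow, Real.sqrt_mul hRd]
  push_cast
  field_simp

/-- **THE COARSE-POINT IDENTITY** `Q J_R = R^{-d/2}·1`: sampling the interpolated field at the coarse
points gives back the field (times `R^{-d/2}`, the ratio of the `ℓ²` normalisations of the two lattices).
[folklore] -/
theorem Smp_mul_Jmat :
    Smp N R M * Jmat N R M
      = (((Real.sqrt ((R : ℝ) ^ d))⁻¹ : ℝ) : ℂ)
          • (1 : Matrix (Tor (fine N M) × Fin d) (Tor (fine N M) × Fin d) ℂ) := by
  rw [← sqrt_card_ratio N R M, Jmat, ← Matrix.mul_assoc, ← Matrix.mul_assoc, Smp_star_dftV_Jhat,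
    Matrix.smul_mul, star_dftV_mul]

/-- **`(J_R f)(R·x, μ) = R^{-d/2} f(x, μ)`** for every field `f` on `T_η` and every coarse point `x`.
[folklore] -/
theorem Jmat_mulVec_cpt (f : Tor (fine N M) × Fin d → ℂ) (x : Tor (fine N M)) (μ : Fin d) :
    (Jmat N R M *ᵥ f) (cpt N R M x, μ) = (((Real.sqrt ((R : ℝ) ^ d))⁻¹ : ℝ) : ℂ) * f (x, μ) := by
  have h := congr_fun (congr_arg (fun A => A *ᵥ f) (Smp_mul_Jmat N R M)) (x, μ)
  rw [← Matrix.mulVec_mulVec, Matrix.smul_mulVec, Matrix.one_mulVec, Pi.smul_apply, smul_eq_mul,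
    Smp_mulVec_apply] at h
  exact h

end Sampling

end Literature.MathematicalPhysics.QuantumFieldTheory.Balaban1983to89.B5G183RateTorus

end
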